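import Literature.MathematicalPhysics.QuantumFieldTheory.Balaban1983to89.B9RWSums343HolderGp

/-!
# `Balaban1983to89.B9RWSums346Lap` — [B9] the L² lines ‖hΔ_UG(U)J‖ and ‖hG(U)Δ_UJ‖ of (3.46) for the random walk sums (3.107) ∕
# (3.90) PROVED inside the leaves of Theorems 3.10 ∕ 3.7 at the all-blocks pins: a sup majorant of GΔ_U from the transposed
# identities (3.105) ∕ (3.88) as a scale-weighted left fixed point, then the Schur test with the transpose letter (Δ_UG)ᵀ = GΔ_U

T. Bałaban, *Propagators for lattice gauge theories in a background field*, Commun. Math. Phys. **99** (1985) 389–434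
[`Balaban1985BackgroundPropagators`, "B9"]; [4] = T. Bałaban, *Propagators and renormalization transformations for lattice
gauge theories. II*, Commun. Math. Phys. **96** (1984) 223–250 [`Balaban1984PropagatorsII`].

statement-level skeleton of published theorems with citation tags; proofs where landed; nothing here is a claim about the
Yang–Mills mass gap

THE PRINTED LOCI (verbatim).  (3.46), p. 398: *"Finally, we have the inequalities in L²-norms ‖hG′(U)λ‖, ‖h∇_UG′(U)λ‖,
‖hG′(U)∇\*_Uλ‖, ‖hΔ_UG′(U)λ‖, … ≦ B₀[(L^jη)², L^jη, L^jη, 1, 1, 1]|h|e^{−δ₀d(y,y′)}‖λ‖ for supp h ⊂ Δ(y), y ∈ Λ_j, supp λ ⊂ Δ(y′)"*;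
p. 398: *"At first the choice of derivatives ∇_U, ∇\*_U is conventional, we may always replace ∇_U by ∇\*_U, and vice versa, in
arbitrary place and combination. Next, the choice of powers L^jη is conventional also. Using Lemma 2.1 in [4] we may replace
the factor (L^jη)^α by (L^jη)^β(L^{j′}η)^γ with β + γ = α"*; p. 391: *"The adjoints are taken with respect to natural L² scalar
products"*; Theorem 3.11 p. 416: *"It is a symmetric and invertible operator"*; (3.105)–(3.106) p. 414: *"Δ_aG₀ = I − R"*,
*"G = G₀(I − R)⁻¹"*; (3.88) p. 409: *"Δ′_aG′₀ = I − Σ_□K(h_□)G′_□h_□ = I − R′"*; Theorem 3.7 p. 409 ∕ Theorem 3.10 p. 416: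
*"convergent in all norms appearing in the inequalities (3.42)–(3.47)"*.

THE POINT.  The siblings prove inside the leaves at the ALL-BLOCKS pins: the (3.42) clauses and the (3.47) lines
(`B9RWSums343to347Whole`), the L² lines (3.46)₁,₂,₃ (`B9RWSums346Schur`: the Schur test needs the sup majorant of the operator
AND of its transpose — available for G (symmetric) and for the pair ∇_UG, G∇\*_U) and the Hölder member (3.43) (`B9RWSums343Holder`
∕ `…Gp`).  The line ‖hΔ_UGJ‖ stayed displayed because (Δ_UG)ᵀ = GΔ_U is NOT among the four sup majorants of the pins.  THIS FILE
supplies the missing sup majorant of GΔ_U — from the TRANSPOSED identities (G = G₀ + R♯G ∕ G′ = G′₀ + VG′, the left fixed points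
the lineage already uses for the right entry G∇\*_U) with the legs (h_□G_□h_□)∘Δ_U POSITED (p. 398: the placement of the two
derivatives is *"conventional … in arbitrary place and combination"*) — and then runs the Schur test of the sibling:

* §1 ENGINES: `weightedMember_of_localLegs` — a member T = Σ_□T₀,□ + V∘T of a scale-weighted LEFT fixed point (V majorised by
  θ·L^jη(L^{j′}η)⁻¹e^{−δ₀d}, the transposed factors) with UNWEIGHTED head legs: `B6RandomWalkHom.hom_majorant_of_leftFixedPoint_weighted`
  at W = L^jη, Q = (L^jη)⁻¹ with p. 398's transfer of the power (L^jη)⁻¹ ((2.60), `B9RWSums346Schur.scaleTransfer_len_rpow` at γ = −1):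
  T has the scale-weighted majorant K·L^jη(L^{j′}η)⁻¹e^{−(1−2α)δ₀d}; `blockBd_pair_of_transpose` — the Schur test for a pair
  (A₃, A₅) of mutually transposed operators with majorants Ce^{−δd} and K₅L^jη(L^{j′}η)⁻¹e^{−δ₅d} (δ ≦ δ₅) followed by the transfer
  at γ = ±½: BOTH have the L² block bound √(CK₅)·L₀·e^{−(1−α)δd(y,y′)} — the printed shape of (3.46) with the prefactor 1.
* §2 THE SUM G(U) OF (3.107): `LapLegs310` (the legs (h_□G_□h_□)∘Δ_U, localized, POSITED), `lapConst`, `lap_of_local310` (one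
  member, one U: the scale-weighted sup majorant of G(U)∘Δ_U), ★ `thm310Printed_allPin_schur_holder_lap` — the leaf at
  `W310OfOps … (ConvAll3107 …)` with (3.42) + (3.47) + (3.43) + (3.46)₁,₂,₃,₄,₆ PROVED inside (the lines n = 3 and n = 5 of
  `B9.KernelFamily.l2` co-read by Δ_UG(U) and G(U)Δ_U); displayed: (3.44), (3.45) and the line n = 4.
* §3 THE SUM G′(U) OF (3.90): `LapLegs37`, `lap_of_local37` (V's scale-weighted majorant by `B9Thm37Glue.rightR_cube_majorant`),
  ★ `thm37Printed_allPin_schur_holder_lap`.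

HONEST SCOPE.  Nothing of print is asserted.  The legs (h_□G_□h_□)∘Δ_U (Cor. 3.6's (3.42)₄ with the Laplacian on the right of
the local operator, localized; NOT one of the four displayed entries — p. 398's convention), the transpose letters
`IsTransposePair (Δ_U∘G) (G∘Δ_U)` (true for the symmetric G, G′, Δ_U of Theorem 3.11, hypotheses on the letters here), the L²
co-readings of the lines n = 3, 5 and the member facts at Corollary 3.6's rate are HYPOTHESES of printed shape; the two-sided
line ‖h∇_UG∇\*_UJ‖ (no sup majorant: (3.44) is an input-Hölder bound) and the input-side Hölder members (3.44), (3.45) stay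
displayed.  Kernel-checked bookkeeping shrinking a located residual; NOT a node discharge, NOT summit progress; one finite
lattice paper; nothing continuum, nothing about the mass gap.  Cell `pub-ymgap` (HUMAN RULING D-0062), Track A node N06 [B9],
seat `pub-ymgap-dag-n06-k` (rows 18–19, successor gen), 2026-08-27.
-/

namespace Literature.MathematicalPhysics.QuantumFieldTheory.Balaban1983to89.B9RWSums346Lap

open Literature.MathematicalPhysics.QuantumFieldTheory.Balaban1983to89
open Finset B6RandomWalk B6RandomWalkHom B9Thm37Sum B9Thm34Ext B9Thm37Glue B9Thm37Whole B9Cor38Whole B9Thm310Whole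
open B9RWSums343to347Whole B9RWSums346Schur B9Thm37GlueCor36 B9RWSums343Holder B9RWSums343HolderGp
open B9SectDL2Decay B9Ineq347 B9Ineq347AllEntries

noncomputable section

/-! ## §1 Engines: a scale-weighted left fixed point with unweighted legs; the Schur test for a transposed pair -/

section Engines

variable {g : B9.Geometry} [Fintype g.Site] {R : ℝ} {H : Prop} {X : Type}

/-- p. 398's transfer of the power (L^jη)⁻¹ under the member facts ((2.60) at the exponent α, the size condition): (L^jη)⁻¹ ≦
L₀·(L^{j′}η)⁻¹·e^{αδd(y,y′)} — `scaleTransfer_len_rpow` at γ = −1 read backwards (d symmetric).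
[cite: Balaban1985BackgroundPropagators, p.398 remark after (3.47); Balaban1984PropagatorsII, Lemma 2.1 (2.60) p.234] -/
theorem inv_len_transfer {d : ℕ} {δ α L₀ : ℝ} (hF : Facts347 g R H d δ α L₀)
    (hsymm : ∀ y y' : g.Site, g.dist y y' = g.dist y' y) (hlen : ∀ y : g.Site, 0 < g.len y) (a b : g.Site) :
    (g.len a)⁻¹ ≤ L₀ * (g.len b)⁻¹ * Real.exp (α * δ * g.dist a b) := by
  have hst : Real.exp (-(α * δ * g.dist b a)) * g.len a ^ (-1 : ℝ) ≤ g.L ^ |(-1 : ℝ)| * g.len b ^ (-1 : ℝ) :=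
    scaleTransfer_len_rpow hF (-1) (by norm_num) b a
  have hL1 : g.L ^ |(-1 : ℝ)| ≤ L₀ := by
    rw [abs_neg, abs_one, Real.rpow_one]; exact hF.L_le
  have hra : g.len a ^ (-1 : ℝ) = (g.len a)⁻¹ := Real.rpow_neg_one (g.len a)
  have hrb : g.len b ^ (-1 : ℝ) = (g.len b)⁻¹ := Real.rpow_neg_one (g.len b)
  rw [hra, hrb, hsymm b a] at hst
  have hb0 : 0 ≤ (g.len b)⁻¹ := inv_nonneg.mpr (hlen b).le
  have h1 : Real.exp (-(α * δ * g.dist a b)) * (g.len a)⁻¹ ≤ L₀ * (g.len b)⁻¹ :=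
    hst.trans (mul_le_mul_of_nonneg_right hL1 hb0)
  have h2 : (g.len a)⁻¹ = (Real.exp (-(α * δ * g.dist a b)) * (g.len a)⁻¹) * Real.exp (α * δ * g.dist a b) := by
    rw [mul_comm (Real.exp _) _, mul_assoc, ← Real.exp_add, neg_add_cancel, Real.exp_zero, mul_one]
  rw [h2]
  exact mul_le_mul_of_nonneg_right h1 (Real.exp_nonneg _)

/-- **A MEMBER OF A SCALE-WEIGHTED LEFT FIXED POINT WITH UNWEIGHTED HEAD LEGS** (the mechanism for GΔ_U = G₀Δ_U + R♯(GΔ_U), the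
transposed (3.105) multiplied by Δ_U on the right): T = Σ_□T₀,□ + V∘T on a finite lattice, V with the scale-weighted majorant
θ·L^jη(L^{j′}η)⁻¹·e^{−δ₀d} (`B9Thm310Whole.Factors389.facT` summed; `B9Thm37Glue.rightR_cube_majorant` summed), θc₁(α) < 1, the head
terms with the localized majorants χ_□(y)·A·e^{−δ₀d}, Σ_□χ_□ ≦ N, and p. 398's transfer of (L^jη)⁻¹ (`inv_len_transfer`, member facts
at (δ₀, α)): T has the majorant NAL₀c₁(α)(1 − θc₁(α))⁻¹·L^jη(L^{j′}η)⁻¹·e^{−(1−2α)δ₀d(y,y′)} —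
`B6RandomWalkHom.hom_majorant_of_leftFixedPoint_weighted` at W = L^jη, Q = (L^jη)⁻¹.
[cite: Balaban1985BackgroundPropagators, (3.105)–(3.106) p.414 + p.398; Balaban1984PropagatorsII, Prop. 2.2 (2.66) p.234 + Lemma 2.1 (2.60)–(2.61) p.234] -/
theorem weightedMember_of_localLegs [Fintype X] [DecidableEq X] {ι : Type} [Fintype ι] (blk : X → g.Site)
    (d d' : ℕ) (δ₀ α θ A N L₀ : ℝ) (χ : ι → g.Site → ℝ)
    (hA : 0 ≤ A) (hN : 0 ≤ N) (hθ : 0 ≤ θ) (hδ₀ : 0 ≤ δ₀) (hα : 0 ≤ α) (hα2 : α ≤ 1 / 2)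
    (htri : Triangle254 (toB6 g R H)) (hrefl : ∀ y : g.Site, g.dist y y = 0)
    (hsymm : ∀ y y' : g.Site, g.dist y y' = g.dist y' y) (hdnn : ∀ y y' : g.Site, 0 ≤ g.dist y y')
    (hlen : ∀ y : g.Site, 0 < g.len y) (h261 : Ineq261 d (toB6 g R H) δ₀ α) (hF : Facts347 g R H d' δ₀ α L₀)
    (hsmall : θ * B6.c1 d δ₀ α < 1) (hχN : ∀ a, ∑ i, χ i a ≤ N)
    {T : (X → ℝ) →ₗ[ℝ] (X → ℝ)} {T₀ : ι → (X → ℝ) →ₗ[ℝ] (X → ℝ)} {V : Module.End ℝ (X → ℝ)}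
    (hfix : T = (∑ i, T₀ i) + V ∘ₗ T)
    (hV : HasMajorant (g := toB6 g R H) blk V
      (fun (a b : g.Site) => θ * g.len a * (g.len b)⁻¹ * Real.exp (-(δ₀ * g.dist a b))))
    (hlegs : ∀ i, HasMajorantHom (g := toB6 g R H) blk blk (T₀ i)
      (fun (a b : g.Site) => χ i a * (A * Real.exp (-(δ₀ * g.dist a b))))) :
    HasMajorantHom (g := toB6 g R H) blk blk T
      (fun (a b : g.Site) => N * A * L₀ * B6.c1 d δ₀ α * (1 - θ * B6.c1 d δ₀ α)⁻¹ * (g.len a * (g.len b)⁻¹) *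
        Real.exp (-((1 - 2 * α) * δ₀ * g.dist a b))) := by
  have hlen0 : ∀ y : g.Site, 0 ≤ g.len y := fun y => (hlen y).le
  have hαδ : 0 ≤ α * δ₀ := mul_nonneg hα hδ₀
  have hαδ2 : 0 ≤ (1 - 2 * α) * δ₀ := mul_nonneg (by linarith) hδ₀
  have h263 : Ineq263 d (toB6 g R H) δ₀ α := ineq263_of_261 d (toB6 g R H) δ₀ α htri hδ₀ (by linarith) h261
  have hL₀ : 0 ≤ L₀ := le_trans (le_trans zero_le_one hF.one_le_L) hF.L_le
  -- the head terms: Σχ·A·e ≤ NA·e = NA·L^jη·(L^jη)⁻¹·e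
  have hT₀ : HasMajorantHom (g := toB6 g R H) blk blk (∑ i, T₀ i)
      (fun (a b : g.Site) => N * A * g.len a * (g.len a)⁻¹ * Real.exp (-(δ₀ * g.dist a b))) := by
    refine hasMajorantHom_mono (g := toB6 g R H) blk blk (hasMajorantHom_fintypeSum blk blk (fun i => T₀ i) _ hlegs)
      fun a b => ?_
    have hone : g.len a * (g.len a)⁻¹ = 1 := mul_inv_cancel₀ (hlen a).ne'
    have h1 : 0 ≤ A * Real.exp (-(δ₀ * g.dist a b)) := mul_nonneg hA (Real.exp_nonneg _)
    calc (∑ i, χ i a * (A * Real.exp (-(δ₀ * g.dist a b))))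
        = (∑ i, χ i a) * (A * Real.exp (-(δ₀ * g.dist a b))) := by rw [Finset.sum_mul]
      _ ≤ N * (A * Real.exp (-(δ₀ * g.dist a b))) := mul_le_mul_of_nonneg_right (hχN a) h1
      _ = N * A * (g.len a * (g.len a)⁻¹) * Real.exp (-(δ₀ * g.dist a b)) := by rw [hone]; ring
      _ = N * A * g.len a * (g.len a)⁻¹ * Real.exp (-(δ₀ * g.dist a b)) := by ring
  have hmain := hom_majorant_of_leftFixedPoint_weighted (g := toB6 g R H) blk blk d δ₀ α θ (N * A) L₀
    (fun y => g.len y) (fun y => (g.len y)⁻¹) (mul_nonneg hN hA) hL₀ hlen (fun y => inv_nonneg.mpr (hlen0 y)) hθ hαδ hαδ2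
    htri hrefl hsymm hdnn h261 h263 hsmall (fun a b => inv_len_transfer hF hsymm hlen a b) hT₀ hV hfix
  refine hasMajorantHom_mono (g := toB6 g R H) blk blk hmain fun a b => le_of_eq ?_
  simp only [toB6_dist]
  ring

/-- `B9.pref6 t 3 = 1` and `B9.pref6 t 5 = 1` (the prefactors of the lines ‖hΔ_UGJ‖, ‖hGΔ_UJ‖). [cite: Balaban1985BackgroundPropagators, (3.46) p.398] -/
theorem pref6_three_five (t : ℝ) : B9.pref6 t 3 = 1 ∧ B9.pref6 t 5 = 1 := by
  simp [B9.pref6]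

/-- The square-root step of the Schur bound for a transposed pair with majorants Ce^{−δd} and K₅·s·e^{−δ₅d} (s ≧ 0 a scale ratio,
δ ≦ δ₅, d ≧ 0): √(C e^{−δd} · K₅ s e^{−δ₅d}) ≦ √(CK₅)·√s·e^{−δd}. [folklore] -/
private theorem sqrt_pair_le {C K₅ δ δ₅ s t : ℝ} (hC : 0 ≤ C) (hK₅ : 0 ≤ K₅) (hs : 0 ≤ s) (ht : 0 ≤ t) (hδ₅ : δ ≤ δ₅) :
    Real.sqrt ((C * Real.exp (-(δ * t))) * (K₅ * s * Real.exp (-(δ₅ * t)))) ≤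
      Real.sqrt (C * K₅) * Real.sqrt s * Real.exp (-(δ * t)) := by
  have hexp : Real.exp (-(δ₅ * t)) ≤ Real.exp (-(δ * t)) :=
    Real.exp_le_exp.mpr (neg_le_neg (mul_le_mul_of_nonneg_right hδ₅ ht))
  have hnn : 0 ≤ Real.sqrt (C * K₅) * Real.sqrt s * Real.exp (-(δ * t)) :=
    mul_nonneg (mul_nonneg (Real.sqrt_nonneg _) (Real.sqrt_nonneg _)) (Real.exp_nonneg _)
  have hsq : (Real.sqrt (C * K₅) * Real.sqrt s * Real.exp (-(δ * t))) ^ 2 = C * K₅ * s * (Real.exp (-(δ * t))) ^ 2 := by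
    rw [mul_pow, mul_pow, Real.sq_sqrt (mul_nonneg hC hK₅), Real.sq_sqrt hs]
  have hle : (C * Real.exp (-(δ * t))) * (K₅ * s * Real.exp (-(δ₅ * t))) ≤
      (Real.sqrt (C * K₅) * Real.sqrt s * Real.exp (-(δ * t))) ^ 2 := by
    rw [hsq]
    have h1 : 0 ≤ C * K₅ * s * Real.exp (-(δ * t)) :=
      mul_nonneg (mul_nonneg (mul_nonneg hC hK₅) hs) (Real.exp_nonneg _)
    calc (C * Real.exp (-(δ * t))) * (K₅ * s * Real.exp (-(δ₅ * t)))
        = (C * K₅ * s * Real.exp (-(δ * t))) * Real.exp (-(δ₅ * t)) := by ring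
      _ ≤ (C * K₅ * s * Real.exp (-(δ * t))) * Real.exp (-(δ * t)) := mul_le_mul_of_nonneg_left hexp h1
      _ = C * K₅ * s * Real.exp (-(δ * t)) ^ 2 := by ring
  calc Real.sqrt ((C * Real.exp (-(δ * t))) * (K₅ * s * Real.exp (-(δ₅ * t))))
      ≤ Real.sqrt ((Real.sqrt (C * K₅) * Real.sqrt s * Real.exp (-(δ * t))) ^ 2) := Real.sqrt_le_sqrt hle
    _ = Real.sqrt (C * K₅) * Real.sqrt s * Real.exp (-(δ * t)) := Real.sqrt_sq hnn

/-- The transfer step at γ = ±½: √(len y₁ ∕ len y₂)·e^{−δd(y,y′)} ≦ L₀·e^{−(1−α)δd(y,y′)} whenever e^{−αδd(y,y′)}√(len y₁) ≦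
L^{½}√(len y₂) (the instance of `ScaleTransfer` at hand). [cite: Balaban1985BackgroundPropagators, p.398 remark after (3.47)] -/
private theorem transfer_half_le {d : ℕ} {δ α L₀ : ℝ} (hF : Facts347 g R H d δ α L₀) {l₁ l₂ t A : ℝ} (hl₂ : 0 < l₂)
    (hA : 0 ≤ A)
    (hst : Real.exp (-(α * δ * t)) * l₁ ^ (1 / 2 : ℝ) ≤ g.L ^ |(1 / 2 : ℝ)| * l₂ ^ (1 / 2 : ℝ)) (hl₁ : 0 ≤ l₁) :
    A * Real.sqrt (l₁ * l₂⁻¹) * Real.exp (-(δ * t)) ≤ A * L₀ * Real.exp (-((1 - α) * δ * t)) := by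
  have hLh : g.L ^ |(1 / 2 : ℝ)| ≤ L₀ := by
    have h1 : g.L ^ |(1 / 2 : ℝ)| ≤ g.L ^ (1 : ℝ) :=
      Real.rpow_le_rpow_of_exponent_le hF.one_le_L (by rw [abs_of_nonneg (by norm_num : (0 : ℝ) ≤ 1 / 2)]; norm_num)
    rw [Real.rpow_one] at h1
    exact h1.trans hF.L_le
  have hsplit : Real.exp (-(δ * t)) = Real.exp (-(α * δ * t)) * Real.exp (-((1 - α) * δ * t)) := by
    rw [← Real.exp_add]; congr 1; ring
  have hsqrt : Real.sqrt (l₁ * l₂⁻¹) = l₁ ^ (1 / 2 : ℝ) * (l₂ ^ (1 / 2 : ℝ))⁻¹ := by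
    rw [Real.sqrt_eq_rpow, Real.mul_rpow hl₁ (inv_nonneg.mpr hl₂.le), Real.inv_rpow hl₂.le]
  have hl₂h : 0 < l₂ ^ (1 / 2 : ℝ) := Real.rpow_pos_of_pos hl₂ _
  rw [hsqrt, hsplit]
  have hkey : l₁ ^ (1 / 2 : ℝ) * (l₂ ^ (1 / 2 : ℝ))⁻¹ * Real.exp (-(α * δ * t)) ≤ L₀ := by
    rw [mul_comm, ← mul_assoc, mul_inv_le_iff₀ hl₂h]
    exact hst.trans (mul_le_mul_of_nonneg_right hLh hl₂h.le)
  calc A * (l₁ ^ (1 / 2 : ℝ) * (l₂ ^ (1 / 2 : ℝ))⁻¹) * (Real.exp (-(α * δ * t)) * Real.exp (-((1 - α) * δ * t)))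
      = A * (l₁ ^ (1 / 2 : ℝ) * (l₂ ^ (1 / 2 : ℝ))⁻¹ * Real.exp (-(α * δ * t))) * Real.exp (-((1 - α) * δ * t)) := by ring
    _ ≤ A * L₀ * Real.exp (-((1 - α) * δ * t)) :=
        mul_le_mul_of_nonneg_right (mul_le_mul_of_nonneg_left hkey hA) (Real.exp_nonneg _)

/-- **THE SCHUR TEST FOR THE TRANSPOSED PAIR (Δ_UG, GΔ_U)** (p. 391: the L² adjoints; p. 398: *"we may always replace ∇_U by ∇\*_U …
in arbitrary place and combination"*, *"the choice of powers L^jη is conventional"*): A₃ with the sup majorant Ce^{−δd} (entry 4 of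
the pins) and its transpose A₅ (`IsTransposePair A₃ A₅`) with the scale-weighted majorant K₅·L^jη(L^{j′}η)⁻¹·e^{−δ₅d}, δ ≦ δ₅, give —
row bounds of one = column bounds of the other (`B9RWSums346Schur.blockBd_schur`), then the transfer at γ = ±½ under the member facts —
the L² block bounds ‖1_{Δ(y)}A₃μ‖₂, ‖1_{Δ(y)}A₅μ‖₂ ≦ √(CK₅)·L₀·e^{−(1−α)δd(y,y′)}‖μ‖₂ for supp μ ⊂ Δ(y′): r1's `BlockBd` with the
prefactors `B9.pref6 _ 3 = 1`, `B9.pref6 _ 5 = 1` of (3.46). [cite: Balaban1985BackgroundPropagators, (3.46) p.398 + p.391 + Thm 3.11 p.416; Balaban1984PropagatorsII, Lemma 2.1 (2.60) p.234] -/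
theorem blockBd_pair_of_transpose [Fintype X] {d : ℕ} {δ α L₀ C K₅ δ₅ : ℝ} (hF : Facts347 g R H d δ α L₀) (hC : 0 ≤ C)
    (hK₅ : 0 ≤ K₅) (hsymm : ∀ y y' : g.Site, g.dist y y' = g.dist y' y) (hdnn : ∀ y y' : g.Site, 0 ≤ g.dist y y')
    (hlen : ∀ y : g.Site, 0 < g.len y) (hδ₅ : δ ≤ δ₅) (blk : X → g.Site) {A3 A5 : Module.End ℝ (X → ℝ)}
    (h3 : HasMajorantHom (g := toB6 g R H) blk blk A3 (fun (a b : g.Site) => C * Real.exp (-(δ * g.dist a b))))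
    (h5 : HasMajorantHom (g := toB6 g R H) blk blk A5
      (fun (a b : g.Site) => K₅ * (g.len a * (g.len b)⁻¹) * Real.exp (-(δ₅ * g.dist a b))))
    (hadj : IsTransposePair A3 A5) :
    BlockBd (g := toB6 g R H) blk blk A3
        (fun (y y' : g.Site) => Real.sqrt (C * K₅) * L₀ * B9.pref6 (g.len y) 3 * Real.exp (-((1 - α) * δ * g.dist y y'))) ∧
      BlockBd (g := toB6 g R H) blk blk A5
        (fun (y y' : g.Site) => Real.sqrt (C * K₅) * L₀ * B9.pref6 (g.len y) 5 * Real.exp (-((1 - α) * δ * g.dist y y'))) := by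
  have hlen0 : ∀ y : g.Site, 0 ≤ g.len y := fun y => (hlen y).le
  have hK : ∀ a b : g.Site, 0 ≤ C * Real.exp (-(δ * g.dist a b)) := fun a b => mul_nonneg hC (Real.exp_nonneg _)
  have hK' : ∀ a b : g.Site, 0 ≤ K₅ * (g.len a * (g.len b)⁻¹) * Real.exp (-(δ₅ * g.dist a b)) := fun a b =>
    mul_nonneg (mul_nonneg hK₅ (mul_nonneg (hlen0 a) (inv_nonneg.mpr (hlen0 b)))) (Real.exp_nonneg _)
  have hS3 := blockBd_schur (G := toB6 g R H) blk blk hK hK' h3 h5 hadj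
  have hS5 := blockBd_schur (G := toB6 g R H) blk blk hK' hK h5 h3 hadj.symm
  have hsq0 : 0 ≤ Real.sqrt (C * K₅) := Real.sqrt_nonneg _
  have hhalf : |(1 / 2 : ℝ)| ≤ 4 := by rw [abs_of_nonneg (by norm_num : (0 : ℝ) ≤ 1 / 2)]; norm_num
  refine ⟨hS3.mono fun y y' => ?_, hS5.mono fun y y' => ?_⟩
  · -- √(C e^{−δd(y,y′)} · K₅ (len y′/len y) e^{−δ₅d(y′,y)}) ≤ √(CK₅) √(len y′/len y) e^{−δd} ≤ √(CK₅) L₀ e^{−(1−α)δd}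
    rw [(pref6_three_five (g.len y)).1, mul_one]
    show Real.sqrt ((C * Real.exp (-(δ * g.dist y y'))) * (K₅ * (g.len y' * (g.len y)⁻¹) * Real.exp (-(δ₅ * g.dist y' y)))) ≤
      Real.sqrt (C * K₅) * L₀ * Real.exp (-((1 - α) * δ * g.dist y y'))
    rw [hsymm y' y]
    refine (sqrt_pair_le hC hK₅ (mul_nonneg (hlen0 y') (inv_nonneg.mpr (hlen0 y))) (hdnn y y') hδ₅).trans ?_
    have hst : Real.exp (-(α * δ * g.dist y y')) * g.len y' ^ (1 / 2 : ℝ) ≤ g.L ^ |(1 / 2 : ℝ)| * g.len y ^ (1 / 2 : ℝ) :=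
      scaleTransfer_len_rpow hF (1 / 2 : ℝ) hhalf y y'
    exact transfer_half_le hF (hlen y) hsq0 hst (hlen0 y')
  · -- √(K₅ (len y/len y′) e^{−δ₅d(y,y′)} · C e^{−δd(y′,y)}) ≤ √(CK₅) √(len y/len y′) e^{−δd} ≤ √(CK₅) L₀ e^{−(1−α)δd}
    rw [(pref6_three_five (g.len y)).2, mul_one]
    show Real.sqrt ((K₅ * (g.len y * (g.len y')⁻¹) * Real.exp (-(δ₅ * g.dist y y'))) * (C * Real.exp (-(δ * g.dist y' y)))) ≤
      Real.sqrt (C * K₅) * L₀ * Real.exp (-((1 - α) * δ * g.dist y y'))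
    rw [hsymm y' y, mul_comm (K₅ * (g.len y * (g.len y')⁻¹) * Real.exp (-(δ₅ * g.dist y y'))) _]
    refine (sqrt_pair_le hC hK₅ (mul_nonneg (hlen0 y) (inv_nonneg.mpr (hlen0 y'))) (hdnn y y') hδ₅).trans ?_
    -- transfer at γ = −½: e^{−αδd(y,y′)} (len y′)^{−½} ≤ L^{½} (len y)^{−½}, i.e. with l₁ = len y, l₂ = len y′ after inversion
    have hst : Real.exp (-(α * δ * g.dist y y')) * g.len y' ^ (-(1 / 2) : ℝ) ≤
        g.L ^ |(-(1 / 2) : ℝ)| * g.len y ^ (-(1 / 2) : ℝ) :=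
      scaleTransfer_len_rpow hF (-(1 / 2) : ℝ) (by rw [abs_neg]; exact hhalf) y y'
    -- rewrite (len ·)^(−½) = ((len ·)^(½))⁻¹ and turn hst into the shape of `transfer_half_le` with l₁ = len y, l₂ = len y′
    have hst' : Real.exp (-(α * δ * g.dist y y')) * g.len y ^ (1 / 2 : ℝ) ≤ g.L ^ |(1 / 2 : ℝ)| * g.len y' ^ (1 / 2 : ℝ) := by
      have hy : 0 < g.len y ^ (1 / 2 : ℝ) := Real.rpow_pos_of_pos (hlen y) _
      have hy' : 0 < g.len y' ^ (1 / 2 : ℝ) := Real.rpow_pos_of_pos (hlen y') _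
      have e1 : g.len y' ^ (-(1 / 2) : ℝ) = (g.len y' ^ (1 / 2 : ℝ))⁻¹ := Real.rpow_neg (hlen0 y') _
      have e2 : g.len y ^ (-(1 / 2) : ℝ) = (g.len y ^ (1 / 2 : ℝ))⁻¹ := Real.rpow_neg (hlen0 y) _
      have habs : |(-(1 / 2) : ℝ)| = |(1 / 2 : ℝ)| := abs_neg _
      rw [e1, e2, habs] at hst
      -- hst : exp · (l₂^{½})⁻¹ ≤ L^{½} · (l₁^{½})⁻¹  ⇒  exp · l₁^{½} ≤ L^{½} · l₂^{½}
      have h1 := mul_le_mul_of_nonneg_right hst (mul_nonneg hy.le hy'.le)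
      have lhs : Real.exp (-(α * δ * g.dist y y')) * (g.len y' ^ (1 / 2 : ℝ))⁻¹ * (g.len y ^ (1 / 2 : ℝ) * g.len y' ^ (1 / 2 : ℝ))
          = Real.exp (-(α * δ * g.dist y y')) * g.len y ^ (1 / 2 : ℝ) := by
        field_simp
      have rhs : g.L ^ |(1 / 2 : ℝ)| * (g.len y ^ (1 / 2 : ℝ))⁻¹ * (g.len y ^ (1 / 2 : ℝ) * g.len y' ^ (1 / 2 : ℝ))
          = g.L ^ |(1 / 2 : ℝ)| * g.len y' ^ (1 / 2 : ℝ) := by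
        field_simp
      rw [lhs, rhs] at h1
      exact h1
    exact transfer_half_le hF (hlen y') hsq0 hst' (hlen0 y)

end Engines

/-! ## §2 The sum G(U) of (3.107): the legs (h_□G_□h_□)∘Δ_U, the majorant of G(U)Δ_U, the leaf with the lines n = 3, 5 proved -/

section GSide

variable {g : B9.Geometry} [Fintype g.Site] [DecidableEq g.Site] {R : ℝ} {H : Prop} {B : B9.Backgrounds}
variable {X Y ι A : Type}

/-- **THE LEGS (h_□G_□(U)h_□)∘Δ_U OF THE HEAD TERMS OF (3.107), LOCALIZED** — Corollary 3.6's sup entry with the Laplacian on the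
RIGHT of the local operator (p. 398: *"we may always replace ∇_U by ∇\*_U, and vice versa, in arbitrary place and combination"*;
(3.42)₄ prints Δ_UG): |(h_□G_□h_□Δ_UJ)(x)| ≦ 1_{S_L(□)}(y)·B_L·e^{−δ₀d(y,y′)}|J| for x ∈ Δ(y), supp J ⊂ Δ(y′).  POSITED AS A WHOLE
(in print: the bound for G_□Δ_U and the right Leibniz rule of Δ_U through h_□ with the sizes (3.100), not displayed).
A HYPOTHESIS SCHEMA; Corollary 3.6 is not asserted. [cite: Balaban1985BackgroundPropagators, Cor. 3.6 p.408 + (3.42) p.397 + p.398 + (3.100) p.413] -/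
structure LapLegs310 (𝔬 : Ops310 g B X Y ι A) (R : ℝ) (H : Prop) (SL : ι → Finset g.Site) (BL δ₀ : ℝ) (U : B.Cfg) :
    Prop where
  right : ∀ i, HasMajorantHom (g := toB6 g R H) 𝔬.blk 𝔬.blk ((mulOp (𝔬.h i) * 𝔬.Gsq U i * mulOp (𝔬.h i)) ∘ₗ 𝔬.Lap U)
    (fun (a b : g.Site) => (if a ∈ SL i then (1 : ℝ) else 0) * (BL * Real.exp (-(δ₀ * g.dist a b))))

/-- **The constant of the scale-weighted majorant of GΔ_U for the sum**: 2·N_L·B_L·L₀·c₁(α) (the legs summed with the overlap count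
N_L, the transfer constant L₀ of (L^jη)⁻¹, the Neumann factor ≦ 2 of «M sufficiently large»).
[cite: Balaban1985BackgroundPropagators, Thm 3.10 p.416 + p.398; Balaban1984PropagatorsII, Lemma 2.1 (2.61) p.234] -/
def lapConst (d : ℕ) (δ₀ α NL BL L₀ : ℝ) : ℝ :=
  2 * NL * BL * L₀ * B6.c1 d δ₀ α

/-- **THE SUP MAJORANT OF G(U)Δ_U FOR THE SUM (3.107) AT ONE MEMBER AND ONE U**: from the transposed (3.105) (G = G₀ + R♯G,
`B9Thm37Glue.fixedPoint_of_388T`) multiplied by Δ_U on the right, the legs `LapLegs310` summed with N_L, the scale-weighted factor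
bounds `Factors389.facT` summed with N_F, [4] (2.61) at (δ₀, α), the member facts at (δ₀, α) for the transfer of (L^jη)⁻¹, and the
located smallness N_Fθ₀M⁻¹c₁(α) ≦ ½: GΔ_U has the majorant `lapConst …`·L^jη(L^{j′}η)⁻¹·e^{−(1−2α)δ₀d(y,y′)} (`weightedMember_of_localLegs`).
[cite: Balaban1985BackgroundPropagators, Thm 3.10 (3.105)–(3.107) pp.414–416 + p.413 + p.398; Balaban1984PropagatorsII, Prop 2.2 (2.66) p.234] -/
theorem lap_of_local310 [Fintype X] [DecidableEq X] [Fintype ι] [Fintype A]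
    (𝔬 : Ops310 g B X Y ι A) (R : ℝ) (H : Prop) (d d' : ℕ) (δ₀ α ρ N N' NF Cℓ θ₀ NL BL L₀ : ℝ) (κ : Sizes310)
    (SL : ι → Finset g.Site) (U : B.Cfg)
    (hδ₀ : 0 ≤ δ₀) (hα : 0 ≤ α) (hα2 : α ≤ 1 / 2) (hNF : 0 ≤ NF) (hθ₀ : 0 ≤ θ₀) (hNL : 0 ≤ NL) (hBL : 0 ≤ BL)
    (hM : 0 < g.M) (hs : StaticOK310 𝔬 ρ N N' NF Cℓ κ)
    (hcntL : ∀ a : g.Site, (∑ i, if a ∈ SL i then (1 : ℝ) else 0) ≤ NL)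
    (h261 : Ineq261 d (toB6 g R H) δ₀ α) (hF : Facts347 g R H d' δ₀ α L₀)
    (hq : NF * (θ₀ * g.M⁻¹) * B6.c1 d δ₀ α ≤ 1 / 2)
    (hf : Factors389 𝔬 R H θ₀ δ₀ U) (hi : Identities310 𝔬 R H U) (hL : LapLegs310 𝔬 R H SL BL δ₀ U) :
    HasMajorantHom (g := toB6 g R H) 𝔬.blk 𝔬.blk (𝔬.G U ∘ₗ 𝔬.Lap U)
      (fun (a b : g.Site) => lapConst d δ₀ α NL BL L₀ * (g.len a * (g.len b)⁻¹) * Real.exp (-((1 - 2 * α) * δ₀ * g.dist a b))) := by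
  have hlen : ∀ y : g.Site, 0 ≤ g.len y := fun y => (hs.lenpos y).le
  have htri : Triangle254 (toB6 g R H) := fun a b c => hs.tri a b c
  have hc1 : 0 ≤ B6.c1 d δ₀ α := c1_nonneg d δ₀ α
  have hMinv0 : 0 ≤ g.M⁻¹ := inv_nonneg.mpr hM.le
  have hθM : 0 ≤ θ₀ * g.M⁻¹ := mul_nonneg hθ₀ hMinv0
  have hθ : 0 ≤ NF * (θ₀ * g.M⁻¹) := mul_nonneg hNF hθM
  have hsmall : NF * (θ₀ * g.M⁻¹) * B6.c1 d δ₀ α < 1 := by linarith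
  have hL₀ : 0 ≤ L₀ := le_trans (le_trans zero_le_one hF.one_le_L) hF.L_le
  -- R♯ = Σ_a R♯_a: the scale-weighted majorant N_F·θ₀M⁻¹·L^jη(L^{j′}η)⁻¹·e^{−δ₀d}
  have hV : HasMajorant (g := toB6 g R H) 𝔬.blk (∑ a, 𝔬.Rt U a)
      (fun (y y' : g.Site) => NF * (θ₀ * g.M⁻¹) * g.len y * (g.len y')⁻¹ * Real.exp (-(δ₀ * g.dist y y'))) := by
    rw [← hasMajorantHom_iff (g := toB6 g R H) 𝔬.blk]
    refine hasMajorantHom_mono (g := toB6 g R H) 𝔬.blk 𝔬.blk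
      (hasMajorantHom_fintypeSum 𝔬.blk 𝔬.blk (fun a => 𝔬.Rt U a) _ fun a =>
        (hasMajorantHom_iff (g := toB6 g R H) 𝔬.blk _ _).mpr (hf.facT a)) fun (y y' : g.Site) => ?_
    have h3 : 0 ≤ (θ₀ * g.M⁻¹) * (g.len y * (g.len y')⁻¹) * Real.exp (-(δ₀ * g.dist y y')) :=
      mul_nonneg (mul_nonneg hθM (mul_nonneg (hlen y) (inv_nonneg.mpr (hlen y')))) (Real.exp_nonneg _)
    calc (∑ a, (if y' ∈ 𝔬.SF a then (1 : ℝ) else 0) * (θ₀ * g.M⁻¹) * (g.len y * (g.len y')⁻¹) *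
            Real.exp (-(δ₀ * g.dist y y')))
        = (∑ a, if y' ∈ 𝔬.SF a then (1 : ℝ) else 0) *
            ((θ₀ * g.M⁻¹) * (g.len y * (g.len y')⁻¹) * Real.exp (-(δ₀ * g.dist y y'))) := by
          rw [Finset.sum_mul]
          exact Finset.sum_congr rfl fun a _ => by ring
      _ ≤ NF * ((θ₀ * g.M⁻¹) * (g.len y * (g.len y')⁻¹) * Real.exp (-(δ₀ * g.dist y y'))) :=
          mul_le_mul_of_nonneg_right (hs.cntF y') h3
      _ = NF * (θ₀ * g.M⁻¹) * g.len y * (g.len y')⁻¹ * Real.exp (-(δ₀ * g.dist y y')) := by ring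
  -- the transposed (3.105) times Δ_U: GΔ_U = G₀Δ_U + R♯(GΔ_U)
  have hGT : 𝔬.G U = (∑ i, mulOp (𝔬.h i) * 𝔬.Gsq U i * mulOp (𝔬.h i)) + (∑ a, 𝔬.Rt U a) * 𝔬.G U :=
    fixedPoint_of_388T hi.invT hi.eq3105T
  have hsumL : (∑ i, mulOp (𝔬.h i) * 𝔬.Gsq U i * mulOp (𝔬.h i)) ∘ₗ 𝔬.Lap U =
      ∑ i, (mulOp (𝔬.h i) * 𝔬.Gsq U i * mulOp (𝔬.h i)) ∘ₗ 𝔬.Lap U := by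
    apply LinearMap.ext
    intro μ
    simp only [LinearMap.comp_apply, LinearMap.sum_apply]
  have hfix : 𝔬.G U ∘ₗ 𝔬.Lap U = (∑ i, (mulOp (𝔬.h i) * 𝔬.Gsq U i * mulOp (𝔬.h i)) ∘ₗ 𝔬.Lap U) +
      (∑ a, 𝔬.Rt U a) ∘ₗ (𝔬.G U ∘ₗ 𝔬.Lap U) := by
    conv_lhs => rw [hGT]
    rw [LinearMap.add_comp, Module.End.mul_eq_comp, LinearMap.comp_assoc, hsumL]
  have e5 := weightedMember_of_localLegs (R := R) (H := H) 𝔬.blk d d' δ₀ α (NF * (θ₀ * g.M⁻¹)) BL NL L₀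
    (fun i (a : g.Site) => if a ∈ SL i then (1 : ℝ) else 0) hBL hNL hθ hδ₀ hα hα2 htri hs.refl hs.symm hs.dnn hs.lenpos h261 hF
    hsmall hcntL hfix hV hL.right
  refine hasMajorantHom_mono (g := toB6 g R H) 𝔬.blk 𝔬.blk e5 fun a b => ?_
  have hinv : (1 - NF * (θ₀ * g.M⁻¹) * B6.c1 d δ₀ α)⁻¹ ≤ 2 := by
    rw [inv_le_comm₀ (by linarith) (by norm_num : (0 : ℝ) < 2)]
    linarith
  have hA0 : 0 ≤ NL * BL * L₀ * B6.c1 d δ₀ α := mul_nonneg (mul_nonneg (mul_nonneg hNL hBL) hL₀) hc1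
  have h1 : NL * BL * L₀ * B6.c1 d δ₀ α * (1 - NF * (θ₀ * g.M⁻¹) * B6.c1 d δ₀ α)⁻¹ ≤ lapConst d δ₀ α NL BL L₀ := by
    calc NL * BL * L₀ * B6.c1 d δ₀ α * (1 - NF * (θ₀ * g.M⁻¹) * B6.c1 d δ₀ α)⁻¹
        ≤ NL * BL * L₀ * B6.c1 d δ₀ α * 2 := mul_le_mul_of_nonneg_left hinv hA0
      _ = lapConst d δ₀ α NL BL L₀ := by unfold lapConst; ring
  have hw : 0 ≤ g.len a * (g.len b)⁻¹ := mul_nonneg (hlen a) (inv_nonneg.mpr (hlen b))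
  exact mul_le_mul_of_nonneg_right (mul_le_mul_of_nonneg_right h1 hw) (Real.exp_nonneg _)

omit [Fintype g.Site] [DecidableEq g.Site] in
/-- The constant `lapConst` is ≧ 0 for nonnegative letters. [folklore] -/
private theorem lapConst_nonneg {d : ℕ} {δ₀ α NL BL L₀ : ℝ} (hNL : 0 ≤ NL) (hBL : 0 ≤ BL) (hL₀ : 0 ≤ L₀) :
    0 ≤ lapConst d δ₀ α NL BL L₀ := by
  have hc1 : 0 ≤ B6.c1 d δ₀ α := c1_nonneg d δ₀ α
  unfold lapConst
  positivity

omit [DecidableEq g.Site] in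
/-- **THE TWO L² LINES FROM THE PAIR (Δ_UG, GΔ_U) AT THE PIN'S CONSTANTS**: the sup majorant Ce^{−δd} of Δ_UG (the pin), the
scale-weighted majorant K₅L^jη(L^{j′}η)⁻¹e^{−δ₅d} of GΔ_U (this file), δ ≦ δ₅, the transpose letter, the L² co-readings of the lines
n = 3 and n = 5 by these operators, the member facts and √(CK₅)·L₀ ≦ B₀, δ₀ ≦ (1 − α)δ give the lines n = 3, 5 of (3.46) AS TYPED at
(B₀, δ₀). [cite: Balaban1985BackgroundPropagators, (3.46) p.398 + p.391] -/
theorem l2lines35_of_majorants [Fintype X] {K : B9.KernelFamily g B} {U : B.Cfg} (blk : X → g.Site) (ev : g.Loc → X → ℝ)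
    {A3 A5 : Module.End ℝ (X → ℝ)} {d : ℕ} {C δ α L₀ K₅ δ₅ B₀ δ₀ : ℝ} (hF : Facts347 g R H d δ α L₀) (hC : 0 ≤ C)
    (hK₅ : 0 ≤ K₅) (hsymm : ∀ y y' : g.Site, g.dist y y' = g.dist y' y) (hdnn : ∀ y y' : g.Site, 0 ≤ g.dist y y')
    (hlen : ∀ y : g.Site, 0 < g.len y) (hδ₅ : δ ≤ δ₅) (hB : Real.sqrt (C * K₅) * L₀ ≤ B₀) (hδ₀ : δ₀ ≤ (1 - α) * δ)
    (h3 : HasMajorantHom (g := toB6 g R H) blk blk A3 (fun (a b : g.Site) => C * Real.exp (-(δ * g.dist a b))))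
    (h5 : HasMajorantHom (g := toB6 g R H) blk blk A5
      (fun (a b : g.Site) => K₅ * (g.len a * (g.len b)⁻¹) * Real.exp (-(δ₅ * g.dist a b))))
    (hadj : IsTransposePair A3 A5)
    (hl3 : L2Reads (R := R) (H := H) K 3 U blk blk ev A3) (hl5 : L2Reads (R := R) (H := H) K 5 U blk blk ev A5) :
    (∀ (lam : g.Loc) (h : g.Cut) (y y' : g.Site), g.cutIn h y → g.suppIn lam y' →
        K.l2 3 U lam h ≤ B₀ * B9.pref6 (g.len y) 3 * g.cutSup h * Real.exp (-(δ₀ * g.dist y y')) * g.l2Norm lam) ∧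
      (∀ (lam : g.Loc) (h : g.Cut) (y y' : g.Site), g.cutIn h y → g.suppIn lam y' →
        K.l2 5 U lam h ≤ B₀ * B9.pref6 (g.len y) 5 * g.cutSup h * Real.exp (-(δ₀ * g.dist y y')) * g.l2Norm lam) := by
  have hlen0 : ∀ y : g.Site, 0 ≤ g.len y := fun y => (hlen y).le
  obtain ⟨hb3, hb5⟩ := blockBd_pair_of_transpose hF hC hK₅ hsymm hdnn hlen hδ₅ blk h3 h5 hadj
  have hB₀ : 0 ≤ B₀ := le_trans (mul_nonneg (Real.sqrt_nonneg _) (le_trans (le_trans zero_le_one hF.one_le_L) hF.L_le)) hB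
  have hmono : ∀ (n : Fin 6) (y y' : g.Site),
      Real.sqrt (C * K₅) * L₀ * B9.pref6 (g.len y) n * Real.exp (-((1 - α) * δ * g.dist y y')) ≤
        B₀ * B9.pref6 (g.len y) n * Real.exp (-(δ₀ * g.dist y y')) := by
    intro n y y'
    have hp : 0 ≤ B9.pref6 (g.len y) n := B9FromB6.pref6_nonneg (hlen0 y) n
    have hexp : Real.exp (-((1 - α) * δ * g.dist y y')) ≤ Real.exp (-(δ₀ * g.dist y y')) :=
      Real.exp_le_exp.mpr (neg_le_neg (mul_le_mul_of_nonneg_right hδ₀ (hdnn y y')))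
    exact mul_le_mul (mul_le_mul_of_nonneg_right hB hp) hexp (Real.exp_nonneg _) (mul_nonneg hB₀ hp)
  exact ⟨l2line_of_blockBd hl3 hB₀ hlen0 (hb3.mono fun y y' => hmono 3 y y'),
    l2line_of_blockBd hl5 hB₀ hlen0 (hb5.mono fun y y' => hmono 5 y y')⟩

omit [Fintype g.Site] [DecidableEq g.Site] in
/-- The lines n ≧ 3 of (3.46) from the lines n = 3, 5 (proved) and the line n = 4 (displayed). [cite: Balaban1985BackgroundPropagators, (3.46) p.398] -/
private theorem l2lines345_of_lines {K : B9.KernelFamily g B} {U : B.Cfg} {B₀ δ₀ : ℝ}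
    (h3 : ∀ (lam : g.Loc) (h : g.Cut) (y y' : g.Site), g.cutIn h y → g.suppIn lam y' →
        K.l2 3 U lam h ≤ B₀ * B9.pref6 (g.len y) 3 * g.cutSup h * Real.exp (-(δ₀ * g.dist y y')) * g.l2Norm lam)
    (h4 : ∀ (lam : g.Loc) (h : g.Cut) (y y' : g.Site), g.cutIn h y → g.suppIn lam y' →
        K.l2 4 U lam h ≤ B₀ * B9.pref6 (g.len y) 4 * g.cutSup h * Real.exp (-(δ₀ * g.dist y y')) * g.l2Norm lam)
    (h5 : ∀ (lam : g.Loc) (h : g.Cut) (y y' : g.Site), g.cutIn h y → g.suppIn lam y' →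
        K.l2 5 U lam h ≤ B₀ * B9.pref6 (g.len y) 5 * g.cutSup h * Real.exp (-(δ₀ * g.dist y y')) * g.l2Norm lam) :
    ∀ (n : Fin 6), 3 ≤ n.val → ∀ (lam : g.Loc) (h : g.Cut) (y y' : g.Site), g.cutIn h y → g.suppIn lam y' →
      K.l2 n U lam h ≤ B₀ * B9.pref6 (g.len y) n * g.cutSup h * Real.exp (-(δ₀ * g.dist y y')) * g.l2Norm lam := by
  intro n hn
  fin_cases n
  · exact absurd hn (by decide)
  · exact absurd hn (by decide)
  · exact absurd hn (by decide)
  · exact h3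
  · exact h4
  · exact h5

omit [Fintype g.Site] [DecidableEq g.Site] in
/-- Arithmetic of «for M sufficiently large»: M ≧ 2N_Fθ₀c₁ gives N_F·θ₀M⁻¹·c₁ ≦ ½. [folklore] -/
private theorem small_of_threshold'' {NF θ₀ c M : ℝ} (hM : 0 < M) (hbig : 2 * NF * θ₀ * c ≤ M) :
    NF * (θ₀ * M⁻¹) * c ≤ 1 / 2 := by
  have h1 : NF * (θ₀ * M⁻¹) * c = (NF * θ₀ * c) / M := by
    rw [div_eq_mul_inv]
    ring
  rw [h1, div_le_iff₀ hM]
  linarith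

end GSide

section AllPinsG

variable {I : Type} {c35 : ℝ} {geo : I → B9.Geometry} {bg : I → B9.Backgrounds}
variable [∀ i, Fintype (geo i).Site] [∀ i, DecidableEq (geo i).Site]

/-- ★ **THEOREM 3.10 AT THE ALL-BLOCKS PIN WITH (3.42) + (3.47) + (3.43) + (3.46)₁,₂,₃,₄,₆ PROVED INSIDE** — the sibling
`B9RWSums343Holder.thm310Printed_allPin_schur_holder` with the displayed residual shrunk once more: only the input-side Hölder
lines (3.44), (3.45) and the two-sided L² line n = 4 (‖h∇_UG∇\*_UJ‖) of `K i` remain displayed (`hrest`).  Inputs beyond the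
sibling's: the L² co-readings of the lines n = 3, 5 by Δ_UG(U), G(U)Δ_U (`L2Reads`), the transpose letter `IsTransposePair
(Δ_U∘G) (G∘Δ_U)`, the legs (h_□G_□h_□)∘Δ_U under Corollary 3.6's provisos (`LapLegs310`, overlap count N_L), the member facts at
Corollary 3.6's rate (δ₁, α₁) for M ≧ M_F (the transfer of (L^jη)⁻¹), α₁ ≦ ½, the pin's rate δ ≦ (1 − 2α₁)δ₁ (equality at the
literal pin of `thm310Printed_of_local3107`) and √(C·lapConst)·L₀ ≦ B₀.  Nothing of print asserted; NOT a node discharge.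
[cite: Balaban1985BackgroundPropagators, Thm 3.10 (3.105)–(3.108) pp.414–416 + (3.42)–(3.47) pp.397–398 + Cor. 3.6 p.408 + p.391; Balaban1984PropagatorsII, Lemma 2.1 (2.60)–(2.61) p.234] -/
theorem thm310Printed_allPin_schur_holder_lap {X Y ι A PX PY : I → Type} [∀ i, Fintype (X i)] [∀ i, DecidableEq (X i)]
    [∀ i, Fintype (Y i)] [∀ i, DecidableEq (Y i)] [∀ i, Fintype (ι i)] [∀ i, Fintype (A i)] [∀ i, Fintype (PX i)]
    [∀ i, DecidableEq (PX i)] [∀ i, Fintype (PY i)] [∀ i, DecidableEq (PY i)]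
    {𝔬 : ∀ i, Ops310 (geo i) (bg i) (X i) (Y i) (ι i) (A i)}
    {rd : ∀ i, WalkReading310 (geo i) (bg i) (X i) (ι i) (A i)} {R : I → ℝ} {H : I → Prop} {C δ : ℝ}
    (𝔭 : ∀ i, HolderProbes (geo i) (bg i) (X i) (Y i) (PX i) (PY i))
    (K : ∀ i, B9.KernelFamily (geo i) (bg i)) (ev : ∀ i, (geo i).Loc → X i → ℝ) (evY : ∀ i, (geo i).Loc → Y i → ℝ)
    {d : ℕ} {α L₀ B₀ δ₀ Mg Mr ar : ℝ} {Bβ Bε : ℝ → ℝ} {Bεβ : ℝ → ℝ → ℝ}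
    (κ : I → Sizes310) (SH : ∀ i, ι i → Finset (geo i).Site) (Bl θH : ℝ → ℝ) (d₁ : ℕ)
    (δ₁ α₁ ρ N N' NF Cℓ θ₀ NH a₁ M₁ ML : ℝ)
    (SL : ∀ i, ι i → Finset (geo i).Site) (NL BL MF : ℝ) (d₁' : ℕ)
    (h310 : B9.Thm310Printed c35 geo bg (fun i => W310OfOps (𝔬 i) (rd i) (Conv3107 (𝔬 i) (R i) (H i) C δ)))
    (hco0 : ∀ i U, CoRealizes (K i) 0 U (𝔬 i).blk (𝔬 i).blk (ev i) ((𝔬 i).G U))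
    (hco1 : ∀ i U, CoRealizes (K i) 1 U (𝔬 i).blkY (𝔬 i).blk (ev i) ((𝔬 i).D U ∘ₗ (𝔬 i).G U))
    (hco2 : ∀ i U, CoRealizes (K i) 2 U (𝔬 i).blk (𝔬 i).blkY (evY i) ((𝔬 i).G U ∘ₗ (𝔬 i).Dstar U))
    (hco3 : ∀ i U, CoRealizes (K i) 3 U (𝔬 i).blk (𝔬 i).blk (ev i) ((𝔬 i).Lap U ∘ₗ (𝔬 i).G U))
    (hgl0 : ∀ i U, GlobReads (K i) 0 U (𝔬 i).blk (𝔬 i).blk (ev i) ((𝔬 i).G U))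
    (hgl1 : ∀ i U, GlobReads (K i) 1 U (𝔬 i).blkY (𝔬 i).blk (ev i) ((𝔬 i).D U ∘ₗ (𝔬 i).G U))
    (hgl2 : ∀ i U, GlobReads (K i) 2 U (𝔬 i).blk (𝔬 i).blkY (evY i) ((𝔬 i).G U ∘ₗ (𝔬 i).Dstar U))
    (hgl3 : ∀ i U, GlobReads (K i) 3 U (𝔬 i).blk (𝔬 i).blk (ev i) ((𝔬 i).Lap U ∘ₗ (𝔬 i).G U))
    (hl0 : ∀ i U, L2Reads (R := R i) (H := H i) (K i) 0 U (𝔬 i).blk (𝔬 i).blk (ev i) ((𝔬 i).G U))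
    (hl1 : ∀ i U, L2Reads (R := R i) (H := H i) (K i) 1 U (𝔬 i).blkY (𝔬 i).blk (ev i) ((𝔬 i).D U ∘ₗ (𝔬 i).G U))
    (hl2 : ∀ i U, L2Reads (R := R i) (H := H i) (K i) 2 U (𝔬 i).blk (𝔬 i).blkY (evY i) ((𝔬 i).G U ∘ₗ (𝔬 i).Dstar U))
    (hl3 : ∀ i U, L2Reads (R := R i) (H := H i) (K i) 3 U (𝔬 i).blk (𝔬 i).blk (ev i) ((𝔬 i).Lap U ∘ₗ (𝔬 i).G U))
    (hl5 : ∀ i U, L2Reads (R := R i) (H := H i) (K i) 5 U (𝔬 i).blk (𝔬 i).blk (ev i) ((𝔬 i).G U ∘ₗ (𝔬 i).Lap U))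
    (hH1 : ∀ i U, H1Reads (K i) U (𝔭 i) (𝔬 i).blk (𝔬 i).blkY (ev i) (evY i) ((𝔬 i).D U ∘ₗ (𝔬 i).G U)
      ((𝔬 i).G U ∘ₗ (𝔬 i).Dstar U))
    (hsym : ∀ i U, IsTransposePair ((𝔬 i).G U) ((𝔬 i).G U))
    (htr : ∀ i U, IsTransposePair ((𝔬 i).D U ∘ₗ (𝔬 i).G U) ((𝔬 i).G U ∘ₗ (𝔬 i).Dstar U))
    (hadjL : ∀ i U, IsTransposePair ((𝔬 i).Lap U ∘ₗ (𝔬 i).G U) ((𝔬 i).G U ∘ₗ (𝔬 i).Lap U))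
    (hfacts : ∀ i, Mg ≤ (geo i).M → Facts347 (geo i) (R i) (H i) d δ α L₀)
    (hdsymm : ∀ i (a b : (geo i).Site), (geo i).dist a b = (geo i).dist b a)
    (hC : 0 ≤ C) (hCB : C ≤ B₀) (hCL : C * L₀ ≤ B₀) (hδ₀ : δ₀ ≤ (1 - α) * δ) (hα : 0 ≤ α * δ)
    (hCg : C * B6.c1 d δ (1 - α) * L₀ ^ (4 : ℝ) ≤ B₀) (har : 0 < ar)
    (hc : 0 < c35) (ha₁ : 0 < a₁) (hα₁ : 0 ≤ α₁) (hα₁2 : α₁ ≤ 1 / 2) (hNF : 0 ≤ NF) (hθ₀ : 0 ≤ θ₀) (hNH : 0 ≤ NH)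
    (hδnn : 0 ≤ δ) (hδ5 : δ ≤ (1 - 2 * α₁) * δ₁) (hδ₁ : 0 ≤ δ₁) (hNL : 0 ≤ NL) (hBL : 0 ≤ BL)
    (hB5 : Real.sqrt (C * lapConst d₁ δ₁ α₁ NL BL L₀) * L₀ ≤ B₀)
    (hst : ∀ i, StaticOK310 (𝔬 i) ρ N N' NF Cℓ (κ i))
    (hcntH : ∀ i (a : (geo i).Site), (∑ q, if a ∈ SH i q then (1 : ℝ) else 0) ≤ NH)
    (hcntL : ∀ i (a : (geo i).Site), (∑ q, if a ∈ SL i q then (1 : ℝ) else 0) ≤ NL)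
    (hBl : ∀ β, 0 ≤ β → β < 1 → 0 ≤ Bl β) (hθH : ∀ β, 0 ≤ β → β < 1 → 0 ≤ θH β)
    (hBβ : ∀ β, 0 ≤ β → β < 1 → holderConst d₁ δ₁ α₁ NH NF C (Bl β) (θH β) ≤ Bβ β)
    (h261 : ∀ i, ML ≤ (geo i).M → Ineq261 d₁ (toB6 (geo i) (R i) (H i)) δ₁ α₁)
    (hF₁ : ∀ i, MF ≤ (geo i).M → Facts347 (geo i) (R i) (H i) d₁' δ₁ α₁ L₀)
    (hop : ∀ i, M₁ ≤ (geo i).M → ∀ α₀ : ℝ, 0 < α₀ → c35 * (geo i).M * α₀ ≤ a₁ →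
      ∀ U : (bg i).Cfg, (bg i).Reg335 c35 α₀ U →
        Factors389 (𝔬 i) (R i) (H i) θ₀ δ₁ U ∧ Identities310 (𝔬 i) (R i) (H i) U ∧
          HolderLegs310 (𝔬 i) (𝔭 i) (R i) (H i) (SH i) Bl δ₁ U ∧ FactorsHolder310 (𝔬 i) (𝔭 i) (R i) (H i) θH δ₁ U)
    (hopL : ∀ i, M₁ ≤ (geo i).M → ∀ α₀ : ℝ, 0 < α₀ → c35 * (geo i).M * α₀ ≤ a₁ →
      ∀ U : (bg i).Cfg, (bg i).Reg335 c35 α₀ U → LapLegs310 (𝔬 i) (R i) (H i) (SL i) BL δ₁ U)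
    -- the displayed residual: (3.44), (3.45), the L² line n = 4
    (hrest : ∀ i, Mr ≤ (geo i).M → ∀ α₀ : ℝ, 0 < α₀ → (geo i).M * α₀ ≤ ar → ∀ U : (bg i).Cfg, (bg i).Reg335 c35 α₀ U →
      (∀ (ε : ℝ) (lam : (geo i).Loc) (y y' : (geo i).Site), 0 < ε → ε ≤ 1 → (geo i).suppInT lam y' →
          (K i).e4 U lam y ≤ Bε ε * Real.exp (-(δ₀ * (geo i).dist y y')) * ((geo i).holder ε lam + (geo i).supNorm lam)) ∧
        (∀ (ε β : ℝ) (lam : (geo i).Loc) (ζ : (geo i).Cut) (y y' : (geo i).Site), 0 < ε → ε ≤ 1 → 0 ≤ β → β < 1 →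
          (geo i).cutInT ζ y → (geo i).suppInT lam y' →
          (K i).h2 U lam β ζ ≤ Bεβ ε β * ((geo i).len y) ^ (-β) * (geo i).cutH β ζ *
            Real.exp (-(δ₀ * (geo i).dist y y')) * ((geo i).holder (β + ε) lam + (geo i).supNorm lam)) ∧
        ∀ (lam : (geo i).Loc) (h : (geo i).Cut) (y y' : (geo i).Site), (geo i).cutIn h y → (geo i).suppIn lam y' →
          (K i).l2 4 U lam h ≤ B₀ * B9.pref6 ((geo i).len y) 4 * (geo i).cutSup h * Real.exp (-(δ₀ * (geo i).dist y y')) *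
            (geo i).l2Norm lam) :
    B9.Thm310Printed c35 geo bg
      (fun i => W310OfOps (𝔬 i) (rd i) (ConvAll3107 (𝔬 i) (R i) (H i) C δ (K i) B₀ δ₀ Bβ Bε Bεβ)) := by
  have hαδ₁ : 0 ≤ α₁ * δ₁ := mul_nonneg hα₁ hδ₁
  have hδδ₁ : δ ≤ (1 - α₁) * δ₁ := hδ5.trans (by nlinarith [hαδ₁])
  have hα₁1 : α₁ ≤ 1 := by linarith
  have h310' := h310
  obtain ⟨M₂, a₀, δc, Cc, cc, hM₂, ha₀, -, -, -, hE⟩ := h310'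
  set Mbig : ℝ := 2 * NF * θ₀ * B6.c1 d₁ δ₁ α₁ with hMbig
  refine thm310Printed_allPin_schur_holder (Mr := max (max Mr Mg) (max (max M₂ M₁) (max (max ML MF) Mbig)))
    (ar := min (min ar a₀) (a₁ / c35)) 𝔭 K ev evY κ SH Bl θH d₁ δ₁ α₁ ρ N N' NF Cℓ θ₀ NH a₁ M₁ ML h310 hco0 hco1 hco2 hco3 hgl0
    hgl1 hgl2 hgl3 hl0 hl1 hl2 hH1 hsym htr hfacts hdsymm hC hCB hCL hδ₀ hα hCg (lt_min (lt_min har ha₀) (div_pos ha₁ hc)) hc ha₁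
    hα₁ hα₁1 hNF hθ₀ hNH hδnn hδδ₁ hδ₁ hst hcntH hBl hθH hBβ h261 hop fun i hM α₀ hα₀ hMa U hU => ?_
  have hMr : Mr ≤ (geo i).M := le_trans (le_trans (le_max_left _ _) (le_max_left _ _)) hM
  have hMg : Mg ≤ (geo i).M := le_trans (le_trans (le_max_right _ _) (le_max_left _ _)) hM
  have hM₂i : M₂ ≤ (geo i).M := le_trans (le_trans (le_trans (le_max_left _ _) (le_max_left _ _)) (le_max_right _ _)) hM
  have hM₁i : M₁ ≤ (geo i).M := le_trans (le_trans (le_trans (le_max_right _ _) (le_max_left _ _)) (le_max_right _ _)) hM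
  have hMLi : ML ≤ (geo i).M :=
    le_trans (le_trans (le_trans (le_trans (le_max_left _ _) (le_max_left _ _)) (le_max_right _ _)) (le_max_right _ _)) hM
  have hMFi : MF ≤ (geo i).M :=
    le_trans (le_trans (le_trans (le_trans (le_max_right _ _) (le_max_left _ _)) (le_max_right _ _)) (le_max_right _ _)) hM
  have hMb : Mbig ≤ (geo i).M := le_trans (le_trans (le_trans (le_max_right _ _) (le_max_right _ _)) (le_max_right _ _)) hM
  have hMpos : 0 < (geo i).M := lt_of_lt_of_le hM₂ hM₂i
  have hMa_ar : (geo i).M * α₀ ≤ ar := hMa.trans ((min_le_left _ _).trans (min_le_left _ _))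
  have hMa₀ : (geo i).M * α₀ ≤ a₀ := hMa.trans ((min_le_left _ _).trans (min_le_right _ _))
  have ha : c35 * (geo i).M * α₀ ≤ a₁ := by
    have h1 : (geo i).M * α₀ * c35 ≤ a₁ := (le_div_iff₀ hc).mp (hMa.trans (min_le_right _ _))
    calc c35 * (geo i).M * α₀ = (geo i).M * α₀ * c35 := by ring
      _ ≤ a₁ := h1
  obtain ⟨h344, h345, h4⟩ := hrest i hMr α₀ hα₀ hMa_ar U hU
  have hconv : Conv3107 (𝔬 i) (R i) (H i) C δ U := (hE i hM₂i α₀ hα₀ hMa₀ U hU).1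
  obtain ⟨-, -, -, h3⟩ := hconv
  obtain ⟨hf, hi, -, -⟩ := hop i hM₁i α₀ hα₀ ha U hU
  have hLap := hopL i hM₁i α₀ hα₀ ha U hU
  have hq : NF * (θ₀ * ((geo i).M)⁻¹) * B6.c1 d₁ δ₁ α₁ ≤ 1 / 2 :=
    small_of_threshold'' hMpos (by rw [hMbig] at hMb; exact hMb)
  have hF₁i := hF₁ i hMFi
  have hL₀ : 0 ≤ L₀ := le_trans (le_trans zero_le_one hF₁i.one_le_L) hF₁i.L_le
  have h5 := lap_of_local310 (𝔬 i) (R i) (H i) d₁ d₁' δ₁ α₁ ρ N N' NF Cℓ θ₀ NL BL L₀ (κ i) (SL i) U hδ₁ hα₁ hα₁2 hNF hθ₀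
    hNL hBL hMpos (hst i) (hcntL i) (h261 i hMLi) hF₁i hq hf hi hLap
  have hlines := l2lines35_of_majorants (R := R i) (H := H i) (𝔬 i).blk (ev i) (hfacts i hMg) hC
    (lapConst_nonneg hNL hBL hL₀) (hdsymm i) (hst i).dnn (hst i).lenpos hδ5 hB5 hδ₀ h3 h5 (hadjL i U) (hl3 i U) (hl5 i U)
  exact ⟨h344, h345, l2lines345_of_lines hlines.1 h4 hlines.2⟩

end AllPinsG

/-! ## §3 The sum G′(U) of (3.90): the legs, the majorant of G′(U)Δ_U, the leaf with the lines n = 3, 5 proved -/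

section GpSide

variable {g : B9.Geometry} [Fintype g.Site] [DecidableEq g.Site] {R : ℝ} {H : Prop} {B : B9.Backgrounds}
variable {X Y ι : Type}

/-- **THE LEGS (h_□G′_□(U)h_□)∘Δ_U OF THE HEAD TERMS OF (3.90), LOCALIZED** (Cor. 3.6's sup entry with the Laplacian on the right,
p. 398's convention; the G′ twin of `LapLegs310`).  POSITED AS A WHOLE; a HYPOTHESIS SCHEMA.
[cite: Balaban1985BackgroundPropagators, Cor. 3.6 p.408 + (3.87) p.409 + (3.42) p.397 + p.398] -/
structure LapLegs37 (𝔬 : Ops g B X Y ι) (R : ℝ) (H : Prop) (SL : ι → Finset g.Site) (BL δ₀ : ℝ) (U : B.Cfg) : Prop where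
  right : ∀ i, HasMajorantHom (g := toB6 g R H) 𝔬.blk 𝔬.blk ((mulOp (𝔬.h i) * 𝔬.Gsq U i * mulOp (𝔬.h i)) ∘ₗ 𝔬.Lap U)
    (fun (a b : g.Site) => (if a ∈ SL i then (1 : ℝ) else 0) * (BL * Real.exp (-(δ₀ * g.dist a b))))

/-- **THE SUP MAJORANT OF G′(U)Δ_U FOR THE SUM (3.90) AT ONE MEMBER AND ONE U**: from the transposed (3.88) (G′ = G′₀ + VG′,
`B9Thm37Glue.fixedPoint_of_388T` with Δ′_aG′ = I by `mul_eq_one_comm`) multiplied by Δ_U on the right, the legs `LapLegs37` summed with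
N_L, the scale-weighted majorants of the V-terms h_□G′_□(∇\*_UPᵗ_□ + Cᵗ_□) (`B9Thm37Glue.rightR_cube_majorant` from Cor. 3.6 entries 1, 3 and
the column sums (3.100)) summed with N′, [4] (2.61) at (δ₀, α), the member facts at (δ₀, α), and the located smallness
N′B₀e^{δ₀ρ}(κ_Pt + C_ℓκ_Ct)c₁(α) ≦ ½ of `B9Thm37Whole.conv342_of_local342`: G′Δ_U has the majorant `lapConst …`·L^jη(L^{j′}η)⁻¹·
e^{−(1−2α)δ₀d(y,y′)}. [cite: Balaban1985BackgroundPropagators, Thm 3.7 (3.87)–(3.90) pp.408–410 + p.398; Balaban1984PropagatorsII, Prop 2.2 (2.66) p.234 + (2.40)–(2.44) p.230] -/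
theorem lap_of_local37 [Fintype X] [DecidableEq X] [Fintype Y] [DecidableEq Y] [Fintype ι]
    (𝔬 : Ops g B X Y ι) (R : ℝ) (H : Prop) (d d' : ℕ) (δ₀ α ρ B₀ N N' Cℓ NL BL L₀ : ℝ) (κ : Sizes) (SL : ι → Finset g.Site)
    (U : B.Cfg)
    (hB₀ : 0 ≤ B₀) (hδ₀ : 0 ≤ δ₀) (hα : 0 ≤ α) (hα2 : α ≤ 1 / 2) (hN' : 0 ≤ N') (hCℓ : 0 ≤ Cℓ) (hNL : 0 ≤ NL) (hBL : 0 ≤ BL)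
    (hs : StaticOK 𝔬 ρ N N' Cℓ κ) (hκ : κ.Nonneg) (hcntL : ∀ a : g.Site, (∑ i, if a ∈ SL i then (1 : ℝ) else 0) ≤ NL)
    (h261 : Ineq261 d (toB6 g R H) δ₀ α) (hF : Facts347 g R H d' δ₀ α L₀)
    (hq' : N' * (B₀ * Real.exp (δ₀ * ρ) * (κ.kPt + Cℓ * κ.kCt)) * B6.c1 d δ₀ α ≤ 1 / 2)
    (hl : Local342 𝔬 R H B₀ δ₀ U) (hi : Identities 𝔬 R H U) (hL : LapLegs37 𝔬 R H SL BL δ₀ U) :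
    HasMajorantHom (g := toB6 g R H) 𝔬.blk 𝔬.blk (𝔬.Gp U ∘ₗ 𝔬.Lap U)
      (fun (a b : g.Site) => lapConst d δ₀ α NL BL L₀ * (g.len a * (g.len b)⁻¹) * Real.exp (-((1 - 2 * α) * δ₀ * g.dist a b))) := by
  have hlen : ∀ y : g.Site, 0 ≤ g.len y := fun y => (hs.lenpos y).le
  have htri : Triangle254 (toB6 g R H) := fun a b c => hs.tri a b c
  have hc1 : 0 ≤ B6.c1 d δ₀ α := c1_nonneg d δ₀ α
  have hk : 0 ≤ κ.kPt + Cℓ * κ.kCt := add_nonneg hκ.kPt (mul_nonneg hCℓ hκ.kCt)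
  have hθ₁ : 0 ≤ B₀ * Real.exp (δ₀ * ρ) * (κ.kPt + Cℓ * κ.kCt) := mul_nonneg (mul_nonneg hB₀ (Real.exp_nonneg _)) hk
  have hθ : 0 ≤ N' * (B₀ * Real.exp (δ₀ * ρ) * (κ.kPt + Cℓ * κ.kCt)) := mul_nonneg hN' hθ₁
  have hsmall : N' * (B₀ * Real.exp (δ₀ * ρ) * (κ.kPt + Cℓ * κ.kCt)) * B6.c1 d δ₀ α < 1 := by linarith
  have hL₀ : 0 ≤ L₀ := le_trans (le_trans zero_le_one hF.one_le_L) hF.L_le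
  -- the V-terms h_□G′_□(∇*Pᵗ_□ + Cᵗ_□), cube by cube (`rightR_cube_majorant`), summed with N′
  have hVi : ∀ i, HasMajorant (g := toB6 g R H) 𝔬.blk (mulOp (𝔬.h i) * 𝔬.Gsq U i * (𝔬.Dstar U ∘ₗ 𝔬.Pt U i + 𝔬.Ct U i))
      (fun (a b : g.Site) => (if b ∈ 𝔬.S' i then (1 : ℝ) else 0) * (B₀ * Real.exp (δ₀ * ρ) * (κ.kPt + Cℓ * κ.kCt)) *
        (g.len a * (g.len b)⁻¹) * Real.exp (-(δ₀ * g.dist a b))) := fun i =>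
    rightR_cube_majorant (R := R) (H := H) 𝔬.blk 𝔬.blkY δ₀ ρ B₀ κ.kPt κ.kCt Cℓ (𝔬.S i) (𝔬.S' i) (𝔬.h i) (𝔬.KPt i) (𝔬.KCt i)
      hB₀ hδ₀ hκ.kPt hκ.kCt hCℓ htri hs.lenpos (hs.hh i) (hs.hS i) (hs.comp i) (hs.KPt_nonneg i) (hs.KPt_loc i) (hs.KPt_col i)
      (hs.KCt_nonneg i) (hs.KCt_loc i) (hs.KCt_col i) (hl.e0 i) (hl.e2 i) (hi.hPt i) (hi.hCt i)
  have hV : HasMajorant (g := toB6 g R H) 𝔬.blk (∑ i, mulOp (𝔬.h i) * 𝔬.Gsq U i * (𝔬.Dstar U ∘ₗ 𝔬.Pt U i + 𝔬.Ct U i))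
      (fun (y y' : g.Site) => N' * (B₀ * Real.exp (δ₀ * ρ) * (κ.kPt + Cℓ * κ.kCt)) * g.len y * (g.len y')⁻¹ *
        Real.exp (-(δ₀ * g.dist y y'))) := by
    rw [← hasMajorantHom_iff (g := toB6 g R H) 𝔬.blk]
    refine hasMajorantHom_mono (g := toB6 g R H) 𝔬.blk 𝔬.blk
      (hasMajorantHom_fintypeSum 𝔬.blk 𝔬.blk (fun i => mulOp (𝔬.h i) * 𝔬.Gsq U i * (𝔬.Dstar U ∘ₗ 𝔬.Pt U i + 𝔬.Ct U i)) _
        fun i => (hasMajorantHom_iff (g := toB6 g R H) 𝔬.blk _ _).mpr (hVi i)) fun (y y' : g.Site) => ?_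
    have h3 : 0 ≤ (B₀ * Real.exp (δ₀ * ρ) * (κ.kPt + Cℓ * κ.kCt)) * (g.len y * (g.len y')⁻¹) * Real.exp (-(δ₀ * g.dist y y')) :=
      mul_nonneg (mul_nonneg hθ₁ (mul_nonneg (hlen y) (inv_nonneg.mpr (hlen y')))) (Real.exp_nonneg _)
    calc (∑ i, (if y' ∈ 𝔬.S' i then (1 : ℝ) else 0) * (B₀ * Real.exp (δ₀ * ρ) * (κ.kPt + Cℓ * κ.kCt)) *
            (g.len y * (g.len y')⁻¹) * Real.exp (-(δ₀ * g.dist y y')))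
        = (∑ i, if y' ∈ 𝔬.S' i then (1 : ℝ) else 0) *
            ((B₀ * Real.exp (δ₀ * ρ) * (κ.kPt + Cℓ * κ.kCt)) * (g.len y * (g.len y')⁻¹) * Real.exp (-(δ₀ * g.dist y y'))) := by
          rw [Finset.sum_mul]
          exact Finset.sum_congr rfl fun i _ => by ring
      _ ≤ N' * ((B₀ * Real.exp (δ₀ * ρ) * (κ.kPt + Cℓ * κ.kCt)) * (g.len y * (g.len y')⁻¹) * Real.exp (-(δ₀ * g.dist y y'))) :=
          mul_le_mul_of_nonneg_right (hs.cnt' y') h3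
      _ = N' * (B₀ * Real.exp (δ₀ * ρ) * (κ.kPt + Cℓ * κ.kCt)) * g.len y * (g.len y')⁻¹ * Real.exp (-(δ₀ * g.dist y y')) := by
          ring
  -- the transposed (3.88) times Δ_U: G′Δ_U = G′₀Δ_U + V(G′Δ_U)
  have hGT : 𝔬.Gp U = (∑ i, mulOp (𝔬.h i) * 𝔬.Gsq U i * mulOp (𝔬.h i)) +
      (∑ i, mulOp (𝔬.h i) * 𝔬.Gsq U i * (𝔬.Dstar U ∘ₗ 𝔬.Pt U i + 𝔬.Ct U i)) * 𝔬.Gp U :=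
    fixedPoint_of_388T (mul_eq_one_comm.mp hi.inv) hi.eq388T
  have hsumL : (∑ i, mulOp (𝔬.h i) * 𝔬.Gsq U i * mulOp (𝔬.h i)) ∘ₗ 𝔬.Lap U =
      ∑ i, (mulOp (𝔬.h i) * 𝔬.Gsq U i * mulOp (𝔬.h i)) ∘ₗ 𝔬.Lap U := by
    apply LinearMap.ext
    intro μ
    simp only [LinearMap.comp_apply, LinearMap.sum_apply]
  have hfix : 𝔬.Gp U ∘ₗ 𝔬.Lap U = (∑ i, (mulOp (𝔬.h i) * 𝔬.Gsq U i * mulOp (𝔬.h i)) ∘ₗ 𝔬.Lap U) +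
      (∑ i, mulOp (𝔬.h i) * 𝔬.Gsq U i * (𝔬.Dstar U ∘ₗ 𝔬.Pt U i + 𝔬.Ct U i)) ∘ₗ (𝔬.Gp U ∘ₗ 𝔬.Lap U) := by
    conv_lhs => rw [hGT]
    rw [LinearMap.add_comp, Module.End.mul_eq_comp, LinearMap.comp_assoc, hsumL]
  have e5 := weightedMember_of_localLegs (R := R) (H := H) 𝔬.blk d d' δ₀ α
    (N' * (B₀ * Real.exp (δ₀ * ρ) * (κ.kPt + Cℓ * κ.kCt))) BL NL L₀ (fun i (a : g.Site) => if a ∈ SL i then (1 : ℝ) else 0)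
    hBL hNL hθ hδ₀ hα hα2 htri hs.refl hs.symm hs.dnn hs.lenpos h261 hF hsmall hcntL hfix hV hL.right
  refine hasMajorantHom_mono (g := toB6 g R H) 𝔬.blk 𝔬.blk e5 fun a b => ?_
  have hinv : (1 - N' * (B₀ * Real.exp (δ₀ * ρ) * (κ.kPt + Cℓ * κ.kCt)) * B6.c1 d δ₀ α)⁻¹ ≤ 2 := by
    rw [inv_le_comm₀ (by linarith) (by norm_num : (0 : ℝ) < 2)]
    linarith
  have hA0 : 0 ≤ NL * BL * L₀ * B6.c1 d δ₀ α := mul_nonneg (mul_nonneg (mul_nonneg hNL hBL) hL₀) hc1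
  have h1 : NL * BL * L₀ * B6.c1 d δ₀ α * (1 - N' * (B₀ * Real.exp (δ₀ * ρ) * (κ.kPt + Cℓ * κ.kCt)) * B6.c1 d δ₀ α)⁻¹ ≤
      lapConst d δ₀ α NL BL L₀ := by
    calc NL * BL * L₀ * B6.c1 d δ₀ α * (1 - N' * (B₀ * Real.exp (δ₀ * ρ) * (κ.kPt + Cℓ * κ.kCt)) * B6.c1 d δ₀ α)⁻¹
        ≤ NL * BL * L₀ * B6.c1 d δ₀ α * 2 := mul_le_mul_of_nonneg_left hinv hA0
      _ = lapConst d δ₀ α NL BL L₀ := by unfold lapConst; ring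
  have hw : 0 ≤ g.len a * (g.len b)⁻¹ := mul_nonneg (hlen a) (inv_nonneg.mpr (hlen b))
  exact mul_le_mul_of_nonneg_right (mul_le_mul_of_nonneg_right h1 hw) (Real.exp_nonneg _)

omit [Fintype g.Site] [DecidableEq g.Site] in
/-- Arithmetic of «for M sufficiently large»: a size s ≦ θ₀M⁻¹ and M ≧ 2N′B₀e^{δ₀ρ}θ₀c₁ give N′B₀e^{δ₀ρ}sc₁ ≦ ½. [folklore] -/
private theorem small_of_size'' {N' B₀ ex s θ₀ c M : ℝ} (hN' : 0 ≤ N') (hB : 0 ≤ B₀ * ex) (hc : 0 ≤ c) (hM : 0 < M)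
    (hs : s ≤ θ₀ * M⁻¹) (hbig : 2 * N' * (B₀ * ex * θ₀) * c ≤ M) : N' * (B₀ * ex * s) * c ≤ 1 / 2 := by
  have h1 : N' * (B₀ * ex * s) * c ≤ N' * (B₀ * ex * (θ₀ * M⁻¹)) * c :=
    mul_le_mul_of_nonneg_right (mul_le_mul_of_nonneg_left (mul_le_mul_of_nonneg_left hs hB) hN') hc
  have h2 : N' * (B₀ * ex * (θ₀ * M⁻¹)) * c = (N' * (B₀ * ex * θ₀) * c) / M := by
    rw [div_eq_mul_inv]
    ring
  have h3 : (N' * (B₀ * ex * θ₀) * c) / M ≤ 1 / 2 := by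
    rw [div_le_iff₀ hM]
    linarith
  exact h1.trans (h2.le.trans h3)

end GpSide

section AllPinsGp

variable {I : Type} {c35 : ℝ} {geo : I → B9.Geometry} {bg : I → B9.Backgrounds}
variable [∀ i, Fintype (geo i).Site] [∀ i, DecidableEq (geo i).Site]

/-- ★ **THEOREM 3.7 AT THE ALL-BLOCKS PIN WITH (3.42) + (3.47) + (3.43) + (3.46)₁,₂,₃,₄,₆ PROVED INSIDE** — the sibling
`B9RWSums343HolderGp.thm37Printed_allPin_schur_holder` with the displayed residual shrunk once more: only (3.44), (3.45) and the
L² line n = 4 of `K i` remain displayed.  Inputs beyond the sibling's: the L² co-readings of the lines n = 3, 5 by Δ_UG′(U), G′(U)Δ_U,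
the transpose letter `IsTransposePair (Δ_U∘G′) (G′∘Δ_U)`, the legs (h_□G′_□h_□)∘Δ_U under Corollary 3.6's provisos (`LapLegs37`, overlap
count N_L), the member facts at Corollary 3.6's rate (δ₁, α₁) for M ≧ M_F, C_ℓ ≧ 0, α₁ ≦ ½, the pin's rate δ ≦ (1 − 2α₁)δ₁ and
√(C·lapConst)·L₀ ≦ B₀; «M sufficiently large» also contains 2N′B₁e^{δ₁ρ}θ₀c₁(α₁) for the column sizes (`Sizes.Bounded.col`).
Nothing of print asserted; NOT a node discharge. [cite: Balaban1985BackgroundPropagators, Thm 3.7 (3.87)–(3.90) pp.408–410 + (3.42)–(3.47) pp.397–398 + Cor. 3.6 p.408 + p.391; Balaban1984PropagatorsII, Lemma 2.1 (2.60)–(2.61) p.234] -/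
theorem thm37Printed_allPin_schur_holder_lap {X Y ι PX PY : I → Type} [∀ i, Fintype (X i)] [∀ i, DecidableEq (X i)]
    [∀ i, Fintype (Y i)] [∀ i, DecidableEq (Y i)] [∀ i, Fintype (ι i)] [∀ i, Fintype (PX i)] [∀ i, DecidableEq (PX i)]
    [∀ i, Fintype (PY i)] [∀ i, DecidableEq (PY i)]
    {𝔴 : ∀ i, B9.RWExpansion (geo i) (bg i)} {𝔬 : ∀ i, Ops (geo i) (bg i) (X i) (Y i) (ι i)}
    {R : I → ℝ} {H : I → Prop} {C δ : ℝ}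
    (𝔭 : ∀ i, HolderProbes (geo i) (bg i) (X i) (Y i) (PX i) (PY i))
    (K : ∀ i, B9.KernelFamily (geo i) (bg i)) (ev : ∀ i, (geo i).Loc → X i → ℝ) (evY : ∀ i, (geo i).Loc → Y i → ℝ)
    {d : ℕ} {α L₀ B₀ δ₀ Mg Mr ar : ℝ} {Bβ Bε : ℝ → ℝ} {Bεβ : ℝ → ℝ → ℝ}
    (κ : I → Sizes) (SH : ∀ i, ι i → Finset (geo i).Site) (Bl BV : ℝ → ℝ) (d₁ : ℕ)
    (δ₁ α₁ ρ N N' Cℓ Kc θ₀ B₁ NH a₁ M₁ ML : ℝ)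
    (SL : ∀ i, ι i → Finset (geo i).Site) (NL BL MF : ℝ) (d₁' : ℕ)
    (h37 : B9.Thm37Printed c35 geo bg (fun i => E37OfOps (𝔴 i) (𝔬 i) (R i) (H i) C δ))
    (hco0 : ∀ i U, CoRealizes (K i) 0 U (𝔬 i).blk (𝔬 i).blk (ev i) ((𝔬 i).Gp U))
    (hco1 : ∀ i U, CoRealizes (K i) 1 U (𝔬 i).blkY (𝔬 i).blk (ev i) ((𝔬 i).D U ∘ₗ (𝔬 i).Gp U))
    (hco2 : ∀ i U, CoRealizes (K i) 2 U (𝔬 i).blk (𝔬 i).blkY (evY i) ((𝔬 i).Gp U ∘ₗ (𝔬 i).Dstar U))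
    (hco3 : ∀ i U, CoRealizes (K i) 3 U (𝔬 i).blk (𝔬 i).blk (ev i) ((𝔬 i).Lap U ∘ₗ (𝔬 i).Gp U))
    (hgl0 : ∀ i U, GlobReads (K i) 0 U (𝔬 i).blk (𝔬 i).blk (ev i) ((𝔬 i).Gp U))
    (hgl1 : ∀ i U, GlobReads (K i) 1 U (𝔬 i).blkY (𝔬 i).blk (ev i) ((𝔬 i).D U ∘ₗ (𝔬 i).Gp U))
    (hgl2 : ∀ i U, GlobReads (K i) 2 U (𝔬 i).blk (𝔬 i).blkY (evY i) ((𝔬 i).Gp U ∘ₗ (𝔬 i).Dstar U))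
    (hgl3 : ∀ i U, GlobReads (K i) 3 U (𝔬 i).blk (𝔬 i).blk (ev i) ((𝔬 i).Lap U ∘ₗ (𝔬 i).Gp U))
    (hl0 : ∀ i U, L2Reads (R := R i) (H := H i) (K i) 0 U (𝔬 i).blk (𝔬 i).blk (ev i) ((𝔬 i).Gp U))
    (hl1 : ∀ i U, L2Reads (R := R i) (H := H i) (K i) 1 U (𝔬 i).blkY (𝔬 i).blk (ev i) ((𝔬 i).D U ∘ₗ (𝔬 i).Gp U))
    (hl2 : ∀ i U, L2Reads (R := R i) (H := H i) (K i) 2 U (𝔬 i).blk (𝔬 i).blkY (evY i) ((𝔬 i).Gp U ∘ₗ (𝔬 i).Dstar U))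
    (hl3 : ∀ i U, L2Reads (R := R i) (H := H i) (K i) 3 U (𝔬 i).blk (𝔬 i).blk (ev i) ((𝔬 i).Lap U ∘ₗ (𝔬 i).Gp U))
    (hl5 : ∀ i U, L2Reads (R := R i) (H := H i) (K i) 5 U (𝔬 i).blk (𝔬 i).blk (ev i) ((𝔬 i).Gp U ∘ₗ (𝔬 i).Lap U))
    (hH1 : ∀ i U, H1Reads (K i) U (𝔭 i) (𝔬 i).blk (𝔬 i).blkY (ev i) (evY i) ((𝔬 i).D U ∘ₗ (𝔬 i).Gp U)
      ((𝔬 i).Gp U ∘ₗ (𝔬 i).Dstar U))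
    (hsym : ∀ i U, IsTransposePair ((𝔬 i).Gp U) ((𝔬 i).Gp U))
    (htr : ∀ i U, IsTransposePair ((𝔬 i).D U ∘ₗ (𝔬 i).Gp U) ((𝔬 i).Gp U ∘ₗ (𝔬 i).Dstar U))
    (hadjL : ∀ i U, IsTransposePair ((𝔬 i).Lap U ∘ₗ (𝔬 i).Gp U) ((𝔬 i).Gp U ∘ₗ (𝔬 i).Lap U))
    (hfacts : ∀ i, Mg ≤ (geo i).M → Facts347 (geo i) (R i) (H i) d δ α L₀)
    (hdsymm : ∀ i (a b : (geo i).Site), (geo i).dist a b = (geo i).dist b a)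
    (hC : 0 ≤ C) (hCB : C ≤ B₀) (hCL : C * L₀ ≤ B₀) (hδ₀ : δ₀ ≤ (1 - α) * δ) (hα : 0 ≤ α * δ)
    (hCg : C * B6.c1 d δ (1 - α) * L₀ ^ (4 : ℝ) ≤ B₀) (har : 0 < ar)
    (hc : 0 < c35) (ha₁ : 0 < a₁) (hα₁ : 0 ≤ α₁) (hα₁2 : α₁ ≤ 1 / 2) (hN' : 0 ≤ N') (hCℓ : 0 ≤ Cℓ)
    (hB₁ : 0 ≤ B₁) (hNH : 0 ≤ NH) (hM₁ : 0 < M₁) (hδnn : 0 ≤ δ) (hδ5 : δ ≤ (1 - 2 * α₁) * δ₁) (hδ₁ : 0 ≤ δ₁) (hNL : 0 ≤ NL)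
    (hBL : 0 ≤ BL) (hB5 : Real.sqrt (C * lapConst d₁ δ₁ α₁ NL BL L₀) * L₀ ≤ B₀)
    (hst : ∀ i, StaticOK (𝔬 i) ρ N N' Cℓ (κ i)) (hκ : ∀ i, (κ i).Bounded Kc θ₀ Cℓ (geo i).M)
    (hcntH : ∀ i (a : (geo i).Site), (∑ q, if a ∈ SH i q then (1 : ℝ) else 0) ≤ NH)
    (hcntL : ∀ i (a : (geo i).Site), (∑ q, if a ∈ SL i q then (1 : ℝ) else 0) ≤ NL)
    (hBl : ∀ β, 0 ≤ β → β < 1 → 0 ≤ Bl β) (hBV : ∀ β, 0 ≤ β → β < 1 → 0 ≤ BV β)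
    (hBβ : ∀ β, 0 ≤ β → β < 1 → holderConst d₁ δ₁ α₁ NH N' C (Bl β) (BV β) ≤ Bβ β)
    (h261 : ∀ i, ML ≤ (geo i).M → Ineq261 d₁ (toB6 (geo i) (R i) (H i)) δ₁ α₁)
    (hF₁ : ∀ i, MF ≤ (geo i).M → Facts347 (geo i) (R i) (H i) d₁' δ₁ α₁ L₀)
    (hop : ∀ i, M₁ ≤ (geo i).M → ∀ α₀ : ℝ, 0 < α₀ → c35 * (geo i).M * α₀ ≤ a₁ →
      ∀ U : (bg i).Cfg, (bg i).Reg335 c35 α₀ U →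
        Local342 (𝔬 i) (R i) (H i) B₁ δ₁ U ∧ Identities (𝔬 i) (R i) (H i) U ∧
          HolderLegs37 (𝔬 i) (𝔭 i) (R i) (H i) (SH i) Bl δ₁ U ∧ HolderV37 (𝔬 i) (𝔭 i) (R i) (H i) BV δ₁ U)
    (hopL : ∀ i, M₁ ≤ (geo i).M → ∀ α₀ : ℝ, 0 < α₀ → c35 * (geo i).M * α₀ ≤ a₁ →
      ∀ U : (bg i).Cfg, (bg i).Reg335 c35 α₀ U → LapLegs37 (𝔬 i) (R i) (H i) (SL i) BL δ₁ U)
    -- the displayed residual: (3.44), (3.45), the L² line n = 4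
    (hrest : ∀ i, Mr ≤ (geo i).M → ∀ α₀ : ℝ, 0 < α₀ → (geo i).M * α₀ ≤ ar → ∀ U : (bg i).Cfg, (bg i).Reg335 c35 α₀ U →
      (∀ (ε : ℝ) (lam : (geo i).Loc) (y y' : (geo i).Site), 0 < ε → ε ≤ 1 → (geo i).suppInT lam y' →
          (K i).e4 U lam y ≤ Bε ε * Real.exp (-(δ₀ * (geo i).dist y y')) * ((geo i).holder ε lam + (geo i).supNorm lam)) ∧
        (∀ (ε β : ℝ) (lam : (geo i).Loc) (ζ : (geo i).Cut) (y y' : (geo i).Site), 0 < ε → ε ≤ 1 → 0 ≤ β → β < 1 →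
          (geo i).cutInT ζ y → (geo i).suppInT lam y' →
          (K i).h2 U lam β ζ ≤ Bεβ ε β * ((geo i).len y) ^ (-β) * (geo i).cutH β ζ *
            Real.exp (-(δ₀ * (geo i).dist y y')) * ((geo i).holder (β + ε) lam + (geo i).supNorm lam)) ∧
        ∀ (lam : (geo i).Loc) (h : (geo i).Cut) (y y' : (geo i).Site), (geo i).cutIn h y → (geo i).suppIn lam y' →
          (K i).l2 4 U lam h ≤ B₀ * B9.pref6 ((geo i).len y) 4 * (geo i).cutSup h * Real.exp (-(δ₀ * (geo i).dist y y')) *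
            (geo i).l2Norm lam) :
    B9.Thm37Printed c35 geo bg (fun i => E37AllOfOps (𝔴 i) (𝔬 i) (R i) (H i) C δ (K i) B₀ δ₀ Bβ Bε Bεβ) := by
  have hαδ₁ : 0 ≤ α₁ * δ₁ := mul_nonneg hα₁ hδ₁
  have hδδ₁ : δ ≤ (1 - α₁) * δ₁ := hδ5.trans (by nlinarith [hαδ₁])
  have hα₁1 : α₁ ≤ 1 := by linarith
  have h37' := h37
  obtain ⟨M₂, a₀, hM₂, ha₀, hE⟩ := h37'
  set Mbig : ℝ := 2 * N' * (B₁ * Real.exp (δ₁ * ρ) * θ₀) * B6.c1 d₁ δ₁ α₁ with hMbig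
  refine thm37Printed_allPin_schur_holder (Mr := max (max Mr Mg) (max (max M₂ M₁) (max (max ML MF) Mbig)))
    (ar := min (min ar a₀) (a₁ / c35)) 𝔭 K ev evY κ SH Bl BV d₁ δ₁ α₁ ρ N N' Cℓ Kc θ₀ B₁ NH a₁ M₁ ML h37 hco0 hco1 hco2 hco3
    hgl0 hgl1 hgl2 hgl3 hl0 hl1 hl2 hH1 hsym htr hfacts hdsymm hC hCB hCL hδ₀ hα hCg (lt_min (lt_min har ha₀) (div_pos ha₁ hc))
    hc ha₁ hα₁ hα₁1 hN' hB₁ hNH hM₁ hδnn hδδ₁ hδ₁ hst hκ hcntH hBl hBV hBβ h261 hop fun i hM α₀ hα₀ hMa U hU => ?_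
  have hMr : Mr ≤ (geo i).M := le_trans (le_trans (le_max_left _ _) (le_max_left _ _)) hM
  have hMg : Mg ≤ (geo i).M := le_trans (le_trans (le_max_right _ _) (le_max_left _ _)) hM
  have hM₂i : M₂ ≤ (geo i).M := le_trans (le_trans (le_trans (le_max_left _ _) (le_max_left _ _)) (le_max_right _ _)) hM
  have hM₁i : M₁ ≤ (geo i).M := le_trans (le_trans (le_trans (le_max_right _ _) (le_max_left _ _)) (le_max_right _ _)) hM
  have hMLi : ML ≤ (geo i).M :=
    le_trans (le_trans (le_trans (le_trans (le_max_left _ _) (le_max_left _ _)) (le_max_right _ _)) (le_max_right _ _)) hM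
  have hMFi : MF ≤ (geo i).M :=
    le_trans (le_trans (le_trans (le_trans (le_max_right _ _) (le_max_left _ _)) (le_max_right _ _)) (le_max_right _ _)) hM
  have hMb : Mbig ≤ (geo i).M := le_trans (le_trans (le_trans (le_max_right _ _) (le_max_right _ _)) (le_max_right _ _)) hM
  have hMpos : 0 < (geo i).M := lt_of_lt_of_le hM₂ hM₂i
  have hMa_ar : (geo i).M * α₀ ≤ ar := hMa.trans ((min_le_left _ _).trans (min_le_left _ _))
  have hMa₀ : (geo i).M * α₀ ≤ a₀ := hMa.trans ((min_le_left _ _).trans (min_le_right _ _))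
  have ha : c35 * (geo i).M * α₀ ≤ a₁ := by
    have h1 : (geo i).M * α₀ * c35 ≤ a₁ := (le_div_iff₀ hc).mp (hMa.trans (min_le_right _ _))
    calc c35 * (geo i).M * α₀ = (geo i).M * α₀ * c35 := by ring
      _ ≤ a₁ := h1
  obtain ⟨h344, h345, h4⟩ := hrest i hMr α₀ hα₀ hMa_ar U hU
  have hconv : Conv342 (𝔬 i) (R i) (H i) C δ U := hE i hM₂i α₀ hα₀ hMa₀ U hU
  obtain ⟨-, -, -, h3⟩ := hconv
  obtain ⟨hl, hi, -, -⟩ := hop i hM₁i α₀ hα₀ ha U hU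
  have hLap := hopL i hM₁i α₀ hα₀ ha U hU
  have hBe : 0 ≤ B₁ * Real.exp (δ₁ * ρ) := mul_nonneg hB₁ (Real.exp_nonneg _)
  have hq' : N' * (B₁ * Real.exp (δ₁ * ρ) * ((κ i).kPt + Cℓ * (κ i).kCt)) * B6.c1 d₁ δ₁ α₁ ≤ 1 / 2 :=
    small_of_size'' hN' hBe (c1_nonneg d₁ δ₁ α₁) hMpos (hκ i).col (by rw [hMbig] at hMb; exact hMb)
  have hF₁i := hF₁ i hMFi
  have hL₀ : 0 ≤ L₀ := le_trans (le_trans zero_le_one hF₁i.one_le_L) hF₁i.L_le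
  have h5 := lap_of_local37 (𝔬 i) (R i) (H i) d₁ d₁' δ₁ α₁ ρ B₁ N N' Cℓ NL BL L₀ (κ i) (SL i) U hB₁ hδ₁ hα₁ hα₁2 hN' hCℓ hNL hBL
    (hst i) (hκ i).nonneg (hcntL i) (h261 i hMLi) hF₁i hq' hl hi hLap
  have hlines := l2lines35_of_majorants (R := R i) (H := H i) (𝔬 i).blk (ev i) (hfacts i hMg) hC
    (lapConst_nonneg hNL hBL hL₀) (hdsymm i) (hst i).dnn (hst i).lenpos hδ5 hB5 hδ₀ h3 h5 (hadjL i U) (hl3 i U) (hl5 i U)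
  exact ⟨h344, h345, l2lines345_of_lines hlines.1 h4 hlines.2⟩

end AllPinsGp

end

end Literature.MathematicalPhysics.QuantumFieldTheory.Balaban1983to89.B9RWSums346Lap
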